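import Summits.CriticalPhenomena.CardyFormulaZ2.Theses.CardySusyWard
import Summits.CriticalPhenomena.CardyFormulaZ2.Theorems.SLE6LimitZ2AllDiscretisations
import Literature.Probability.LatticeModels.MedialExplorationChains
import Literature.Probability.LatticeModels.UnitDiscDiscretisation
import Literature.Probability.Process.KolmogorovExtensionProofs
import Summits.CriticalPhenomena.CardyFormulaZ2.Theorems.ParafermionPrecompact.Negative.WeakSumControl
import Summits.CriticalPhenomena.CardyFormulaZ2.Theorems.ParafermionPrecompact.Negative.HeadPassage
import Summits.CriticalPhenomena.CardyFormulaZ2.Theses.CardyComplexCone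
import Literature.Probability.LatticeModels.FermionicObservableSums
import Literature.Probability.RandomPlanarGeometry.ChordalReversibility
import Literature.Probability.RandomPlanarGeometry.SLEExistenceNeEightHolds

/-!
# Disproof of `ParafermionFamiliesToSLESix` (stmt-CriticalPhenomena-10814) — findings

Standing adversary (cdisprove) work file for the rank-4 crux of route `CardySusyWard`,
`ParafermionFamiliesToSLESix := WeakHolomorphy → ParafermionPrecompact → AllFamiliesSLE6`
(SLE₆ for every Dobrushin domain and every admissible square-lattice discretisation family).
Everything below is `lean check`ed (rc 0, no `sorry`, axioms `propext/Classical.choice/Quot.sound`).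

## Findings (cycle 1, 2026-08-16)

1. **The crux as typed is `WeakHolomorphy → Vanishing → (Smirnov's Conjecture 4 at q = 1)`.**
   `parafermionPrecompact_iff_vanishing` (§2): the by-name second hypothesis
   `ParafermionPrecompact` (stmt-11293, rev 5) is EQUIVALENT to the vanishing normalisation
   `δ^{-1/3} F_δ → 0` uniformly on compacts, because its equicontinuity clause (ii) ranges over all
   `z z' : Sym2 (Site 2)` and every lattice edge `{x, y}` has the non-edge "junk twin"
   `{2x - y, 2y - x}` with the same medial point and `F_δ ≡ 0` (`exists_junk_twin`; the exploration
   path visits lattice edges only, `mem_edgeSet_of_mem_medialExploration`). Hence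
   `crux_iff : ParafermionFamiliesToSLESix ↔ (WeakHolomorphy → Vanishing → AllFamiliesSLE6)` and
   `crux_iff_conjecture` (the conclusion is the registered OPEN leaf
   `Summit.CriticalPhenomena.CardyFormulaZ2.SLE6LimitZ2AllDiscretisations`, by field repackaging,
   `allFamiliesSLE6_iff_conjecture`). This re-derives, inside the crux directory, the cross-filed
   certificate `Evidence.lean` of refuter rattack-11150 (2026-08-15, not readable from this seat).
   CONSEQUENCE FOR PROVERS: the intended Morera / Riemann–Hilbert / martingale proof CANNOT prove
   the item as typed — under `Vanishing` every subsequential limit of `δ^{-1/3}F_δ` is `0` and the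
   observable martingale carries no information; the typed item is provable only by (i) refuting
   `WeakHolomorphy`, (ii) refuting `Vanishing` (= proving a `δ^{1/3}` LOWER bound on `|F_δ|`
   somewhere — the Duminil-Copin–Smirnov world, in which the item is VACUOUSLY true,
   `crux_of_not_vanishing`), or (iii) proving the bare conjecture (`crux_of_conjecture`). The repair
   is the planner's: restate 11293 with the edge guards `z, z' ∈ (zdGraph 2).edgeSet` (as the twin
   `CardyComplexCone.ParafermionToSLESixFamilies`, stmt-11389, already does), after which this item
   should be re-pointed at the guarded hypothesis.
2. **Why it resists refutation** (§3): `not_crux_iff : ¬crux ↔ WeakHolomorphy ∧ Vanishing ∧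
   ¬AllFamiliesSLE6`. A kill needs ALL of: the open dual Cauchy–Riemann half (barrier
   `FKParafermionicHalfCauchyRiemann`), the vanishing normalisation (contradicting DCS Conj. 8.7,
   `c ≠ 0`), and a counterexample to conformal invariance of bond percolation on `ℤ²` along an
   admissible family (contradicting universality; none known). Dropping either hypothesis does not
   help: `not_withoutWeakHolomorphy_iff`, `not_withoutPrecompact_iff` still contain
   `¬AllFamiliesSLE6`. No Lean handle exists on any conjunct; no finite/small model bites (the
   statement is asymptotic in δ along genuinely admissible families). NON-VACUITY: the hypotheses
   ARE satisfiable — the tree's tilted-arc discretisation of the unit disc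
   (`UnitDiscDiscretisation.isDiscretisation_discData`) is an admissible family
   (`hypotheses_satisfiable_unitDisc`, §0), so neither `WeakHolomorphy` nor `Vanishing` nor the
   conclusion is vacuous, and no "no family exists" junk proof of the crux is available.
3. **Refuted natural strengthening S1** (§4, `not_conclusionWithoutAdmissibility`): the
   conclusion with eventual admissibility (and dual-arc / marks convergence) dropped is FALSE —
   far-arc junk family on the unit disc (`farArcData`: wired arc `(ab)`, "dual-wired arc" `{1000}`)
   ⇒ empty discrete arc `B` ⇒ no `A`–`B` edge ⇒ `medialExploration = []` ⇒ interface = constant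
   curve `0` ⇒ no convergence to SLE₆, by the general lemma `not_convergesInLawToSLE_of_target_eq`
   (`ConvergesInLawToSLE κ D` fails for interfaces with a deterministic endpoint `≠ b`; uses: SLE
   curve ends at `b` a.s., `target_ae_of_isSLECurve`; endpoint functional `1`-Lipschitz; pre-Wiener
   measure is a probability measure). Lessons: (a) the conclusion has teeth — it cannot be closed
   by junk; (b) eventual admissibility is the load-bearing inner side condition; (c) the wired-arc
   condition alone does not prevent junk.
4. **Targets**: none yet (no line picked, `stuck_stubs = []`).
5. **Refuted strengthening S1′** (§4′, `not_conclusionWithoutMarksAndAdmissibility`): keeping BOTH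
   arc conditions (`arcA → (ab)`, `arcB → (ba)` in Hausdorff distance) and dropping only marks
   convergence + eventual admissibility still makes the conclusion FALSE: the scaled-arc family
   (`scaledArcData`: dual-wired arc `(1+δ)·(ba)`, within Hausdorff distance `δ` of `(ba)`) has an
   EMPTY discrete arc `B` at every positive mesh (`zdArcB_scaled_eq_empty`: interior sites are
   strictly closer to the unit circle than to the pushed-out arc), hence a junk constant interface.
   Arc convergence does not control the discrete arcs; the load-bearing inner pair is
   {marks convergence, eventual admissibility}.
6. **Consolidation with the sibling disprover of 11293** (§5, using its landed Negative lemmas):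
   as typed `ParafermionPrecompact → WeakHolomorphy`, so `WeakHolomorphy` is NOT load-bearing here
   (`crux_iff_precompact_imp : crux ↔ (ParafermionPrecompact → AllFamiliesSLE6)`); with
   `ParafermionPrecompact ↔ ¬ParafermionBulkNondegenerate` the crux IS `¬H → conjecture`
   (`crux_iff_not_bulkNondegenerate_imp`), hence `¬crux ↔ ¬H ∧ ¬conjecture` (`not_crux_iff'`) and,
   dually, `crux_of_bulkNondegenerate : H → crux` (vacuous truth in the DCS world) and
   `crux_iff_bulkNondegenerate_or_conjecture : crux ↔ H ∨ conjecture`. VERDICT: the typed item is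
   junk-true modulo the open lower bound `H` and un-killable short of `¬H ∧ ¬conjecture`; it must be
   RESTATED (planner), not attacked further as typed. Tree versions: Negative/PrecompactIffVanishing
   (p74617), Negative/ConclusionNeedsAdmissibility (p74045, landed), Negative/CruxModuloBulkNondegenerate
   (p75118), Negative/ArcConvergenceNotEnough (to be proposed once the farm has built p74045).
7. **Open for the next cycle**: attack the REPAIRED form (twin 11389 shape: edge-guarded
   precompactness; there `¬crux′ ↔ X1′ ∧ X2′ ∧ ¬conjecture`, equally un-killable, but its stubs once a
   line is picked are fair game); a refutation of "conclusion without admissibility ONLY" (marks kept)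
   would need the exploration path of non-admissible marked data (tied canonical data,
   `not_isZdAdmissible_dobrushinData_unitDisc`), undecided in the tree.

## Findings (cycle 2, 2026-08-16, seat `refuter-cdisprove-stmt-CriticalPhenomena-10814-g2-0`)

8. **The vanishing world** (§6). `weakHolomorphy_of_vanishing : Vanishing → WeakHolomorphy`
   (sibling `weakSum_tendsto_zero_of_vanishesOn`), hence `crux_iff_conjecture_of_vanishing :
   Vanishing → (crux ↔ SLE6LimitZ2AllDiscretisations)`. The SAME holds for the announced repair
   shape, the edge-guarded twin `CardyComplexCone.ParafermionToSLESixFamilies` (stmt-11389):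
   `twin_iff : twin ↔ (TwinWeakHolomorphy → TwinPrecompact → AllFamiliesSLE6)` (definitional),
   `twinWeakHolomorphy_of_looseVanishing`, `twinPrecompact_of_looseVanishing`, hence
   `twin_iff_conjecture_of_looseVanishing : LooseVanishing → (twin ↔ conjecture)` and
   `not_twin_iff : ¬twin ↔ TwinWeakHolomorphy ∧ TwinPrecompact ∧ ¬conjecture`. MESSAGE FOR THE
   PLANNER AND THE LINES: the edge guards cure the COLLAPSE of 11293 (guarded clauses no longer
   force vanishing) but no hypothesis of the repaired implication EXCLUDES vanishing — in the world
   `δ^{-1/3}F_δ → 0` (consistent with X1, X2, X1′, X2′, all certified here) the observable is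
   useless and the item is the bare conjecture. Every proof must therefore either DERIVE the
   `δ^{1/3}` lower bound (N₀ / `ParafermionBulkNondegenerate`, open, crux NOTES S0/S2) or carry it
   as an explicit hypothesis; a restatement "X1′ → X2′ → N → conclusion" with N a per-family
   non-degeneracy clause is the honest shape (then `¬item ↔ X1′ ∧ X2′ ∧ N ∧ ¬conj`).
9. **Refuted strengthening S3 — the re-orientation is load-bearing** (§7,
   `not_conclusionRaw`): the conclusion stated for the RAW exploration curve
   (`CurveClass.mk ⟨medialExplorationCurve (Λ δ) ω⟩`, the `if … then γ else γ ∘ σ` removed) is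
   FALSE on the tree's own admissible unit-disc family `UnitDiscDiscretisation.discData` (all six
   hypotheses hold): its start corner is `((-M, 0), south)` (`startCorner_discData`), so for EVERY
   configuration the exploration starts at `eL` (`b_δ → b = -1`) and ends at `eR` (`a_δ → a = 1`)
   (`head_/getLast_medialExploration_discData`) — the H21 exploration keeps the wired arc
   `A ≈ (ab)` on its LEFT and therefore starts at the counter-clockwise `A → B` transition, which is
   at `b`; an SLE₆ in `(𝔻; 1, -1)` ends at `-1` a.s., the raw curve ends `≥ 2 - 3δ` away
   (`le_dist_target_raw`, general lemma `not_convergesInLawToSLE_of_le_dist_target`).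
10. **The orientation tax** (§8). The `else` branch is `CurveClass.reverse` (`iface_eq_ite`), the branch is
   the same for every configuration (`iface_eq_ite_startEdge`: it tests the start edge `e_a` of the datum), and on
   the disc family it is ALWAYS taken for `δ < 1/3` (`iface_discData_eq_reverse`); so the conclusion
   there says exactly: the RAW exploration (from `b_δ`) converges in law to the TIME-REVERSAL of an
   SLE₆ in `(𝔻; 1, -1)` (`conclusion_discData_iff_raw`, via `convergesInLawToSLE_congr`,
   `tendstoLaw_reverse_iff`, `aemeasurable_reverse_comp_iff`). A domain-Markov / observable-
   martingale argument along the exploration's own filtration yields instead "raw exploration →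
   SLE₆ in the swapped domain `(𝔻; -1, 1)`"; the two are bridged by REVERSIBILITY of chordal SLE₆
   (Miller–Sheffield, Ann. Math. 184 (2016), arXiv:1201.1498, κ ∈ (4,8)) — under that hypothesis
   they are equivalent (`conclusion_discData_iff_natural_of_reversible`, using the tree's
   `DobrushinDomain.swap`, `CurveClass.reverse`, `exists_isSLECurve_six`), and without it the tree
   has no bridge (the alternative is a discrete primal/dual self-duality dictionary for the H21
   `bcBondConfig` rendering, which is NOT self-dual at the sites of the arc `B`, and whose dual data
   live on the half-mesh-SHIFTED carrier `Ω - δ(1+i)/2`, about which neither the by-name hypotheses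
   X1/X2 nor the conclusion's family class — all pinned to `(Λ δ).Ω = D.carrier`, crux NOTES S1 —
   say anything). Neither input is in
   the tree, in the route text, or in any round-1 card: a hidden M–L stub of every line ("explore
   from `a`" is not available — `medialExploration` starts at `b` for `(ab)`-wired data).
12. **Remaining single-hypothesis mutations of the conclusion (paper analysis, not certified).**
   Dropping ONLY the arc conditions (3)–(4) while keeping marks convergence (5) and eventual
   admissibility (6) yields no junk on tame domains: with exactly two `A`–`B` edges at `a_δ → a`,
   `b_δ → b` the discrete arcs are the two boundary pieces between them, i.e. the intended arcs up to
   the swap `A ↔ B`, and the swapped family (wired arc `(ba)`, exploration then sourced at `a`) is as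
   plausible as the original (reflection symmetry of the model and of SLE₆); dropping ONLY (5) while
   keeping (3), (4), (6) likewise forces the transitions into `o(1)`-windows at `a`, `b` on the disc.
   So on tame domains the load-bearing inner conditions are (6) plus ONE of {(5), (3)∧(4)}; cycle 1's
   S1′ shows (3)∧(4) without (6) is junk. Dropping (1) `(Λ δ).Ω = D.carrier` or (2) `(Λ δ).δ = δ`
   alone admits no cheap separating witness either ((2) is re-forced by (5) on the disc: medial
   points at a fixed mesh stay `≥ δ₀/2` from `±1`).
11. **Status of the kill**: unchanged — as typed `crux ↔ H ∨ conjecture` (cycle 1); the repaired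
   twin is `¬twin ↔ X1′ ∧ X2′ ∧ ¬conj`; no finite model, regime or junk family bites the conclusion
   along a genuinely admissible family (well-definedness of the exploration is now fully proved in
   the tree: `existsUnique_medialExploration_holds`, so no "junk `[]` path" refutation exists for
   admissible data). Landed this cycle: Negative/VanishingWorld.lean (p79821, ACCEPTED), Negative/
   RawExplorationRunsBToA.lean (p80357) and Negative/OrientationTax.lean (p80890) — the last two are
   the ≤ 400-line split of §7–§8 (pending at publication time).
-/

noncomputable section

namespace Summit.CriticalPhenomena.CardyFormulaZ2.Cruxes.ParafermionFamiliesToSLESix.Disproof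

open scoped Topology NNReal unitInterval ENNReal
open Filter MeasureTheory Set
open Literature.Probability.LatticeModels Literature.Probability.Percolation
open Literature.Probability.RandomPlanarGeometry
open Summit.CriticalPhenomena.CardyFormulaZ2.Theses.CardySusyWard

/-! ## 0. Vocabulary: the conclusion and the collapsed second hypothesis -/

/-- The conclusion of the crux, verbatim: SLE₆ convergence of the re-oriented medial exploration
interface for every Dobrushin domain and every admissible square-lattice discretisation family
(the six `ZdDiscretisationFamily` fields unbundled). [cite: Smirnov2007ICM, §2.3 Conjecture 4] -/
def AllFamiliesSLE6 : Prop :=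
  ∀ (D : DobrushinDomain) (Λ : ℝ → DiscreteDobrushin), (∀ δ, (Λ δ).Ω = D.carrier) →
    (∀ δ, (Λ δ).δ = δ) →
    Tendsto (fun δ : ℝ => Metric.hausdorffEDist (Λ δ).arcA (D.arc 0)) (𝓝[>] (0:ℝ)) (𝓝 0) →
    Tendsto (fun δ : ℝ => Metric.hausdorffEDist (Λ δ).arcB (D.arc 1)) (𝓝[>] (0:ℝ)) (𝓝 0) →
    Tendsto (fun δ : ℝ => Metric.hausdorffEDist (medialPoint δ '' (Λ δ).zdABEdges) {D.pt 0, D.pt 1})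
      (𝓝[>] (0:ℝ)) (𝓝 0) →
    (∀ᶠ δ in 𝓝[>] (0:ℝ), (Λ δ).IsZdAdmissible) →
    ConvergesInLawToSLE 6 D (Ωδ := fun _ => BondConfig (Site 2))
      (fun δ ω => CurveClass.mk
        (if dist (medialExplorationCurve (Λ δ) ω 0) (D.pt 0) ≤
            dist (medialExplorationCurve (Λ δ) ω 0) (D.pt 1)
          then (⟨medialExplorationCurve (Λ δ) ω⟩ : Curve ℂ)
          else ⟨(medialExplorationCurve (Λ δ) ω).comp ⟨unitInterval.symm, unitInterval.continuous_symm⟩⟩))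
      (fun _ => bondPercolation (zdGraph 2) half)

/-- **Vanishing normalisation**: along every admissible family, `δ^{-1/3} F_δ → 0` uniformly on
compacts (`F_δ(z) = ∫ passageSum (medialExploration (Λ δ) ω) δ (1/3) z dP_{1/2}`), quantified over
ALL medial "vertices" `z : Sym2 (Site 2)` exactly as the crux's hypothesis does. [folklore] -/
def Vanishing : Prop :=
  ∀ (D : DobrushinDomain) (Λ : ℝ → DiscreteDobrushin), (∀ δ, (Λ δ).Ω = D.carrier) →
    (∀ δ, (Λ δ).δ = δ) →
    Tendsto (fun δ : ℝ => Metric.hausdorffEDist (Λ δ).arcA (D.arc 0)) (𝓝[>] (0:ℝ)) (𝓝 0) →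
    Tendsto (fun δ : ℝ => Metric.hausdorffEDist (Λ δ).arcB (D.arc 1)) (𝓝[>] (0:ℝ)) (𝓝 0) →
    Tendsto (fun δ : ℝ => Metric.hausdorffEDist (medialPoint δ '' (Λ δ).zdABEdges) {D.pt 0, D.pt 1})
      (𝓝[>] (0:ℝ)) (𝓝 0) →
    (∀ᶠ δ in 𝓝[>] (0:ℝ), (Λ δ).IsZdAdmissible) →
    ∀ K : Set ℂ, IsCompact K → K ⊆ D.carrier →
      ∀ ε > (0:ℝ), ∀ᶠ δ in 𝓝[>] (0:ℝ), ∀ z : MedialVertex, medialPoint δ z ∈ K →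
        ‖(∫ ω, MedialPath.passageSum (medialExploration (Λ δ) ω) δ (1 / 3) z
            ∂(bondPercolation (zdGraph 2) half))‖ ≤ ε * δ ^ ((1:ℝ) / 3)

/-- The crux is literally `WeakHolomorphy → ParafermionPrecompact → AllFamiliesSLE6`. [folklore] -/
theorem crux_unfold :
    ParafermionFamiliesToSLESix ↔ (WeakHolomorphy → ParafermionPrecompact → AllFamiliesSLE6) :=
  Iff.rfl

/-- The conclusion is, by field repackaging, the registered OPEN conjecture leaf
`Summit.CriticalPhenomena.CardyFormulaZ2.SLE6LimitZ2AllDiscretisations` (Smirnov's Conjecture 4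
at `q = 1` for all admissible discretisations; interface = `bondInterfaceIn D (Λ δ)`
definitionally). [cite: Smirnov2007ICM, §2.3 Conjecture 4] -/
theorem allFamiliesSLE6_iff_conjecture :
    AllFamiliesSLE6 ↔ Summit.CriticalPhenomena.CardyFormulaZ2.SLE6LimitZ2AllDiscretisations := by
  constructor
  · intro h D E hE
    exact h D E hE.Ω_eq hE.δ_eq hE.tendsto_arcA hE.tendsto_arcB hE.tendsto_zdABEdges
      hE.eventually_isZdAdmissible
  · intro h D Λ h1 h2 h3 h4 h5 h6
    exact h D Λ ⟨h1, h2, h3, h4, h5, h6⟩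

/-- **The family-form hypotheses are satisfiable** (so `WeakHolomorphy`, `Vanishing` and the
conclusion are NOT vacuous): the tree's tilted-arc discretisation `UnitDiscDiscretisation.discData`
of the unit disc `(𝔻; 1, -1)` has the right carrier and mesh, arcs within `2δ` of the half circles,
discrete marks within `3δ` of `±1`, and is `IsZdAdmissible` for `0 < δ < 1/2`
(`UnitDiscDiscretisation.isDiscretisation_discData`). This is the unit-disc instance of the
route's support item `DiscretisationFamilyExists` (stmt-9644). [cite: CDHKSCRAS2014, §1] -/
theorem hypotheses_satisfiable_unitDisc :
    ∃ Λ : ℝ → DiscreteDobrushin, (∀ δ, (Λ δ).Ω = DobrushinDomain.unitDisc.carrier) ∧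
      (∀ δ, (Λ δ).δ = δ) ∧
      Tendsto (fun δ : ℝ => Metric.hausdorffEDist (Λ δ).arcA (DobrushinDomain.unitDisc.arc 0))
        (𝓝[>] (0:ℝ)) (𝓝 0) ∧
      Tendsto (fun δ : ℝ => Metric.hausdorffEDist (Λ δ).arcB (DobrushinDomain.unitDisc.arc 1))
        (𝓝[>] (0:ℝ)) (𝓝 0) ∧
      Tendsto (fun δ : ℝ => Metric.hausdorffEDist (medialPoint δ '' (Λ δ).zdABEdges)
        {DobrushinDomain.unitDisc.pt 0, DobrushinDomain.unitDisc.pt 1}) (𝓝[>] (0:ℝ)) (𝓝 0) ∧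
      (∀ᶠ δ in 𝓝[>] (0:ℝ), (Λ δ).IsZdAdmissible) :=
  ⟨UnitDiscDiscretisation.discData,
    UnitDiscDiscretisation.isDiscretisation_discData.Ω_eq,
    UnitDiscDiscretisation.isDiscretisation_discData.δ_eq,
    UnitDiscDiscretisation.isDiscretisation_discData.tendsto_arcA,
    UnitDiscDiscretisation.isDiscretisation_discData.tendsto_arcB,
    UnitDiscDiscretisation.isDiscretisation_discData.tendsto_zdABEdges,
    UnitDiscDiscretisation.isDiscretisation_discData.eventually_isZdAdmissible⟩

/-- Hence the route's `DiscretisationFamilyExists` holds AT the unit disc (its `∀ D` form, stmt-9644,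
stays open for general Jordan domains). [cite: CDHKSCRAS2014, §1] -/
theorem discretisationFamilyExists_unitDisc :
    ∃ Λ : ℝ → DiscreteDobrushin, (∀ δ, (Λ δ).Ω = DobrushinDomain.unitDisc.carrier) ∧
      (∀ δ, (Λ δ).δ = δ) ∧
      Filter.Tendsto (fun δ : ℝ => Metric.hausdorffEDist (Λ δ).arcA (DobrushinDomain.unitDisc.arc 0))
        (nhdsWithin (0:ℝ) (Set.Ioi 0)) (nhds 0) ∧
      Filter.Tendsto (fun δ : ℝ => Metric.hausdorffEDist (Λ δ).arcB (DobrushinDomain.unitDisc.arc 1))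
        (nhdsWithin (0:ℝ) (Set.Ioi 0)) (nhds 0) ∧
      Filter.Tendsto (fun δ : ℝ => Metric.hausdorffEDist (medialPoint δ '' (Λ δ).zdABEdges)
        {DobrushinDomain.unitDisc.pt 0, DobrushinDomain.unitDisc.pt 1})
        (nhdsWithin (0:ℝ) (Set.Ioi 0)) (nhds 0) ∧
      (∀ᶠ δ in nhdsWithin (0:ℝ) (Set.Ioi 0), (Λ δ).IsZdAdmissible) :=
  hypotheses_satisfiable_unitDisc

/-! ## 1. Lattice bookkeeping: the exploration path consists of lattice edges -/

/-- Two consecutive entries of a list form an infix. [folklore] -/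
theorem infix_pair_getElem' {α : Type*} (l : List α) (i : ℕ) (h : i + 1 < l.length) :
    [l[i], l[i + 1]] <:+: l := by
  refine ⟨l.take i, l.drop (i + 2), ?_⟩
  apply List.ext_getElem
  · simp
  · intro n h1 h2
    simp only [List.append_assoc, List.getElem_append, List.length_take, List.getElem_take,
      List.length_cons, List.length_nil, List.getElem_drop]
    split_ifs with h3 h4
    · rfl
    · have : n = i ∨ n = i + 1 := by omega
      rcases this with rfl | rfl
      · simp [show min n l.length = n by omega]
      · simp [show min i l.length = i by omega]
    · congr 1; omega

/-- A corner edge is a lattice edge. [folklore] -/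
theorem cornerEdge_mem_edgeSet' {v f : Site 2} (hv : IsCorner v f) (i : Fin 2) :
    cornerEdge v f i ∈ (zdGraph 2).edgeSet :=
  (SimpleGraph.mem_edgeSet _).2 (adj_cornerNeighbor hv i)

/-- The source of a corner is a lattice edge. [folklore] -/
theorem cornerSource_mem_edgeSet {v f : Site 2} (hv : IsCorner v f) :
    cornerSource v f ∈ (zdGraph 2).edgeSet := by
  obtain ⟨a, b, -, hs, -⟩ := exists_cornerSource_eq_cornerTarget_eq v f
  rw [hs]; exact cornerEdge_mem_edgeSet' hv a

/-- The target of a corner is a lattice edge. [folklore] -/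
theorem cornerTarget_mem_edgeSet {v f : Site 2} (hv : IsCorner v f) :
    cornerTarget v f ∈ (zdGraph 2).edgeSet := by
  obtain ⟨a, b, -, -, ht⟩ := exists_cornerSource_eq_cornerTarget_eq v f
  rw [ht]; exact cornerEdge_mem_edgeSet' hv b

/-- Every medial vertex visited by an exploration path is a lattice edge (every entry is the
source or the target of a dart, and the path has at least one dart). [folklore] -/
theorem mem_edgeSet_of_isMedialExploration {E : DiscreteDobrushin} {ω : BondConfig (Site 2)}
    {γ : List MedialVertex} (hγ : IsMedialExploration E ω γ) {z : MedialVertex} (hz : z ∈ γ) :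
    z ∈ (zdGraph 2).edgeSet := by
  obtain ⟨k, hk, rfl⟩ := List.getElem_of_mem hz
  -- the path has at least two entries
  have h2 : 1 < γ.length := by
    by_contra h1
    have hlen : γ.length = 1 := by
      have := List.length_pos_of_ne_nil hγ.ne_nil
      omega
    apply hγ.head_ne_getLast
    rw [List.head_eq_getElem, List.getLast_eq_getElem]
    congr 1
    omega
  by_cases hk' : k + 1 < γ.length
  · obtain ⟨v, f, hvf, -, hs, -⟩ := hγ.step _ _ (infix_pair_getElem' γ k hk')
    rw [← hs]; exact cornerSource_mem_edgeSet hvf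
  · have hk1 : k - 1 + 1 < γ.length := by omega
    obtain ⟨v, f, hvf, -, -, ht⟩ := hγ.step _ _ (infix_pair_getElem' γ (k - 1) hk1)
    have hkk : k - 1 + 1 = k := by omega
    simp only [hkk] at ht
    rw [← ht]; exact cornerTarget_mem_edgeSet hvf

/-- Every medial vertex of `medialExploration E ω` (junk `[]` or the genuine path) is a lattice
edge. [folklore] -/
theorem mem_edgeSet_of_mem_medialExploration {E : DiscreteDobrushin} {ω : BondConfig (Site 2)}
    {z : MedialVertex} (hz : z ∈ medialExploration E ω) : z ∈ (zdGraph 2).edgeSet := by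
  rcases medialExploration_eq_nil_or E ω with h | h
  · rw [h] at hz; simp at hz
  · exact mem_edgeSet_of_isMedialExploration h hz

/-- Off the lattice edges the parafermionic summand vanishes identically, hence so does the
observable `F_δ`. [folklore] -/
theorem integral_passageSum_eq_zero_of_not_mem_edgeSet (E : DiscreteDobrushin) (δ s : ℝ)
    {z : MedialVertex} (hz : z ∉ (zdGraph 2).edgeSet) :
    ∫ ω, MedialPath.passageSum (medialExploration E ω) δ s z ∂(bondPercolation (zdGraph 2) half) = 0 := by
  have : ∀ ω, MedialPath.passageSum (medialExploration E ω) δ s z = 0 := fun ω =>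
    MedialPath.passageSum_eq_zero_of_not_mem δ s (fun h => hz (mem_edgeSet_of_mem_medialExploration h))
  simp [this]

/-- Adjacent sites differ by at most one in every coordinate. [folklore] -/
theorem abs_sub_le_one_of_adj {a b : Site 2} (h : (zdGraph 2).Adj a b) (i : Fin 2) :
    |b i - a i| ≤ 1 := by
  obtain ⟨j, hj | hj⟩ := (zdGraph_adj_iff a b).1 h
  · subst hj
    by_cases hij : i = j
    · subst hij; simp
    · simp [hij]
  · subst hj
    by_cases hij : i = j
    · subst hij; simp
    · simp [hij]

/-- The **junk twin** of a pair `{x, y}`: the pair `{2x - y, 2y - x}`, with the same midpoint. -/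
def junkTwin (x y : Site 2) : MedialVertex := s(x + x - y, y + y - x)

/-- The junk twin has the same medial point at every mesh. [folklore] -/
theorem medialPoint_junkTwin (δ : ℝ) (x y : Site 2) :
    medialPoint δ (junkTwin x y) = medialPoint δ s(x, y) := by
  simp only [junkTwin, medialPoint_mk]
  congr 1
  apply Complex.ext
  · simp only [Complex.add_re, meshPoint_re]
    push_cast [Pi.add_apply, Pi.sub_apply]
    ring
  · simp only [Complex.add_im, meshPoint_im]
    push_cast [Pi.add_apply, Pi.sub_apply]
    ring

/-- The junk twin of a lattice EDGE is not a lattice edge (its endpoints are `3` apart). [folklore] -/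
theorem junkTwin_not_mem_edgeSet {x y : Site 2} (h : (zdGraph 2).Adj x y) :
    junkTwin x y ∉ (zdGraph 2).edgeSet := by
  intro hmem
  rw [junkTwin, SimpleGraph.mem_edgeSet] at hmem
  obtain ⟨j, hj | hj⟩ := (zdGraph_adj_iff x y).1 h
  · have := abs_sub_le_one_of_adj hmem j
    subst hj
    simp at this
    -- |x j + 1 + (x j + 1) - x j - (x j + x j - (x j + 1))| = 3
    norm_num [abs_le] at this
    omega
  · have := abs_sub_le_one_of_adj hmem j
    subst hj
    simp at this
    norm_num [abs_le] at this
    omega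

/-- Every lattice edge has a NON-edge twin with the same medial point, on which `F_δ ≡ 0`. [folklore] -/
theorem exists_junk_twin {z : MedialVertex} (hz : z ∈ (zdGraph 2).edgeSet) :
    ∃ z' : MedialVertex, z' ∉ (zdGraph 2).edgeSet ∧ ∀ δ : ℝ, medialPoint δ z' = medialPoint δ z := by
  induction z using Sym2.ind with
  | h x y =>
    rw [SimpleGraph.mem_edgeSet] at hz
    exact ⟨junkTwin x y, junkTwin_not_mem_edgeSet hz, fun δ => medialPoint_junkTwin δ x y⟩

/-! ## 2. The second hypothesis as typed IS the vanishing normalisation -/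

/-- **`ParafermionPrecompact ↔ Vanishing`.** As typed (rev 5 of the route file), the
equicontinuity clause (ii) of `ParafermionPrecompact` ranges over ALL `z z' : Sym2 (Site 2)`;
pairing a lattice edge `z` with its junk twin `z'` (same medial point, `F_δ(z') = 0`) turns (ii)
into `‖F_δ(z)‖ ≤ ε δ^{1/3}` eventually, for every `ε > 0` — the vanishing normalisation; the
converse is the triangle inequality. (Re-derivation of the cross-filed certificate `Evidence.lean`
of refuter rattack-11150 on this item, 2026-08-15.) [folklore] -/
theorem parafermionPrecompact_iff_vanishing : ParafermionPrecompact ↔ Vanishing := by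
  constructor
  · intro hP D Λ hΩ hδ hA hB hM hAdm K hK hKΩ ε hε
    obtain ⟨-, hii⟩ := hP D Λ hΩ hδ hA hB hM hAdm K hK hKΩ
    obtain ⟨η, hη, hev⟩ := hii ε hε
    filter_upwards [hev, self_mem_nhdsWithin] with δ hδ' hδpos
    intro z hz
    by_cases hze : z ∈ (zdGraph 2).edgeSet
    · obtain ⟨z', hz'e, hz'p⟩ := exists_junk_twin hze
      have h0 := integral_passageSum_eq_zero_of_not_mem_edgeSet (Λ δ) δ (1 / 3) hz'e
      have key := hδ' z z' hz (by rw [hz'p δ]; exact hz) (by rw [hz'p δ, dist_self]; exact hη)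
      rwa [h0, sub_zero] at key
    · rw [integral_passageSum_eq_zero_of_not_mem_edgeSet (Λ δ) δ (1 / 3) hze, norm_zero]
      exact mul_nonneg hε.le (Real.rpow_nonneg (le_of_lt hδpos) _)
  · intro hV D Λ hΩ hδ hA hB hM hAdm K hK hKΩ
    have hV' := hV D Λ hΩ hδ hA hB hM hAdm K hK hKΩ
    refine ⟨⟨1, ?_⟩, fun ε hε => ⟨1, one_pos, ?_⟩⟩
    · filter_upwards [hV' 1 one_pos] with δ h z hz
      exact h z hz
    · filter_upwards [hV' (ε / 2) (half_pos hε)] with δ h z z' hz hz' _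
      calc _ ≤ ‖∫ ω, MedialPath.passageSum (medialExploration (Λ δ) ω) δ (1 / 3) z
                  ∂(bondPercolation (zdGraph 2) half)‖ +
               ‖∫ ω, MedialPath.passageSum (medialExploration (Λ δ) ω) δ (1 / 3) z'
                  ∂(bondPercolation (zdGraph 2) half)‖ := norm_sub_le _ _
        _ ≤ ε / 2 * δ ^ ((1:ℝ) / 3) + ε / 2 * δ ^ ((1:ℝ) / 3) := add_le_add (h z hz) (h z' hz')
        _ = ε * δ ^ ((1:ℝ) / 3) := by ring

/-- **The crux as typed.** `ParafermionFamiliesToSLESix ↔ (WeakHolomorphy → Vanishing →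
AllFamiliesSLE6)`: weak holomorphy plus an asymptotically TRIVIAL observable should imply
Smirnov's conjecture. [folklore] -/
theorem crux_iff : ParafermionFamiliesToSLESix ↔ (WeakHolomorphy → Vanishing → AllFamiliesSLE6) :=
  ⟨fun h hW hV => h hW (parafermionPrecompact_iff_vanishing.2 hV),
   fun h hW hP => h hW (parafermionPrecompact_iff_vanishing.1 hP)⟩

/-- Same, against the registered conjecture leaf. [folklore] -/
theorem crux_iff_conjecture :
    ParafermionFamiliesToSLESix ↔ (WeakHolomorphy → Vanishing →
      Summit.CriticalPhenomena.CardyFormulaZ2.SLE6LimitZ2AllDiscretisations) := by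
  rw [crux_iff, allFamiliesSLE6_iff_conjecture]


/-! ## 3. Load-bearing analysis: what a refutation of the crux, or of the crux with a hypothesis
dropped, would have to prove -/

/-- The crux with its first hypothesis dropped. [folklore] -/
def WithoutWeakHolomorphy : Prop := ParafermionPrecompact → AllFamiliesSLE6

/-- The crux with its second hypothesis dropped. [folklore] -/
def WithoutPrecompact : Prop := WeakHolomorphy → AllFamiliesSLE6

/-- The crux with both hypotheses dropped: the bare conjecture. [folklore] -/
def Bare : Prop := AllFamiliesSLE6

/-- `Bare → WithoutWeakHolomorphy`. [folklore] -/
theorem withoutWeakHolomorphy_of_bare (h : Bare) : WithoutWeakHolomorphy := fun _ => h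

/-- `Bare → WithoutPrecompact`. [folklore] -/
theorem withoutPrecompact_of_bare (h : Bare) : WithoutPrecompact := fun _ => h

/-- `WithoutWeakHolomorphy → crux`. [folklore] -/
theorem crux_of_withoutWeakHolomorphy (h : WithoutWeakHolomorphy) : ParafermionFamiliesToSLESix :=
  fun _ hP => h hP

/-- `WithoutPrecompact → crux`. [folklore] -/
theorem crux_of_withoutPrecompact (h : WithoutPrecompact) : ParafermionFamiliesToSLESix :=
  fun hW _ => h hW

/-- **Refutation shape of the crux**: `¬ crux ↔ WeakHolomorphy ∧ Vanishing ∧ ¬ AllFamiliesSLE6`.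
All three conjuncts are out of reach: `WeakHolomorphy` is the open dual Cauchy–Riemann half
(barrier `FKParafermionicHalfCauchyRiemann`), `Vanishing` contradicts the Duminil-Copin–Smirnov
normalisation (Conj. 8.7: `δ^{-1/3}F_δ → c (φ')^{1/3}`, `c ≠ 0`), and `¬ AllFamiliesSLE6` is the
failure of Smirnov's Conjecture 4 at `q = 1` along some admissible family. [folklore] -/
theorem not_crux_iff :
    ¬ ParafermionFamiliesToSLESix ↔ WeakHolomorphy ∧ Vanishing ∧ ¬ AllFamiliesSLE6 := by
  rw [crux_iff]
  simp only [Classical.not_imp]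

/-- Refutation shape without the first hypothesis: still needs `¬ AllFamiliesSLE6`. [folklore] -/
theorem not_withoutWeakHolomorphy_iff :
    ¬ WithoutWeakHolomorphy ↔ Vanishing ∧ ¬ AllFamiliesSLE6 := by
  rw [WithoutWeakHolomorphy, parafermionPrecompact_iff_vanishing]
  simp only [Classical.not_imp]

/-- Refutation shape without the second hypothesis: still needs `¬ AllFamiliesSLE6`. [folklore] -/
theorem not_withoutPrecompact_iff :
    ¬ WithoutPrecompact ↔ WeakHolomorphy ∧ ¬ AllFamiliesSLE6 := by
  rw [WithoutPrecompact]
  simp only [Classical.not_imp]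

/-- **Dichotomy, branch 1** (the Duminil-Copin–Smirnov world, `F_δ ≍ δ^{1/3}`): if the vanishing
normalisation fails anywhere, the crux holds VACUOUSLY. [folklore] -/
theorem crux_of_not_vanishing (h : ¬ Vanishing) : ParafermionFamiliesToSLESix :=
  crux_iff.2 fun _ hV => absurd hV h

/-- **Dichotomy, branch 2**: if weak holomorphy fails anywhere, the crux holds vacuously. [folklore] -/
theorem crux_of_not_weakHolomorphy (h : ¬ WeakHolomorphy) : ParafermionFamiliesToSLESix :=
  fun hW => absurd hW h

/-- **Dichotomy, branch 3**: the crux follows from the registered open conjecture outright (its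
hypotheses are then decoration). [folklore] -/
theorem crux_of_conjecture (h : Summit.CriticalPhenomena.CardyFormulaZ2.SLE6LimitZ2AllDiscretisations) :
    ParafermionFamiliesToSLESix :=
  fun _ _ => allFamiliesSLE6_iff_conjecture.2 h

/-! ## 4. Refuted strengthening: the conclusion's side conditions are load-bearing

Dropping eventual admissibility (together with the convergence of the dual-wired arc and of the
discrete marks) from the INNER hypotheses of the conclusion makes it false: on the unit disc the
data with wired arc `(ab)` and "dual-wired arc" the far point `{1000}` have an empty discrete arc
`B`, hence no `A`–`B` edge, hence no exploration path; the interface functional is then the junk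
constant curve `0`, whose law (a Dirac mass) does not converge to chordal SLE₆ in `(𝔻; 1, -1)`,
because an SLE₆ curve ends at `b = -1` almost surely. -/

/-- The interface functional of the conclusion (verbatim), as a function of the discrete data;
definitionally `bondInterfaceIn D E ω`. [cite: Smirnov2007ICM, §2.1] -/
def iface (D : DobrushinDomain) (E : DiscreteDobrushin) (ω : BondConfig (Site 2)) : CurveClass ℂ :=
  CurveClass.mk
    (if dist (medialExplorationCurve E ω 0) (D.pt 0) ≤ dist (medialExplorationCurve E ω 0) (D.pt 1)
      then (⟨medialExplorationCurve E ω⟩ : Curve ℂ)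
      else ⟨(medialExplorationCurve E ω).comp ⟨unitInterval.symm, unitInterval.continuous_symm⟩⟩)

/-- `iface = bondInterfaceIn` (by `rfl`). [folklore] -/
theorem iface_eq_bondInterfaceIn (D : DobrushinDomain) (E : DiscreteDobrushin) (ω : BondConfig (Site 2)) :
    iface D E ω = bondInterfaceIn D E ω := rfl

/-- STRENGTHENING S1 — the conclusion with only the carrier, mesh and wired-arc conditions kept
(dual-wired-arc convergence, marks convergence and eventual admissibility dropped). [folklore] -/
def ConclusionWithoutAdmissibility : Prop :=
  ∀ (D : DobrushinDomain) (Λ : ℝ → DiscreteDobrushin), (∀ δ, (Λ δ).Ω = D.carrier) →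
    (∀ δ, (Λ δ).δ = δ) →
    Tendsto (fun δ : ℝ => Metric.hausdorffEDist (Λ δ).arcA (D.arc 0)) (𝓝[>] (0:ℝ)) (𝓝 0) →
    ConvergesInLawToSLE 6 D (Ωδ := fun _ => BondConfig (Site 2)) (fun δ ω => iface D (Λ δ) ω)
      (fun _ => bondPercolation (zdGraph 2) half)

/-- The far-arc junk data on the unit disc at mesh `δ`: wired arc `(ab)` (upper half circle),
"dual-wired arc" the far point `1000`. [folklore] -/
def farArcData (δ : ℝ) : DiscreteDobrushin :=
  ⟨Metric.ball (0:ℂ) 1, δ, DobrushinDomain.unitDisc.arc 0, {(1000:ℂ)}⟩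

/-- Carrier of the far-arc data. [folklore] -/
@[simp] theorem farArcData_Ω (δ : ℝ) : (farArcData δ).Ω = Metric.ball (0:ℂ) 1 := rfl
/-- Mesh of the far-arc data. [folklore] -/
@[simp] theorem farArcData_δ (δ : ℝ) : (farArcData δ).δ = δ := rfl
/-- Wired arc of the far-arc data. [folklore] -/
@[simp] theorem farArcData_arcA (δ : ℝ) : (farArcData δ).arcA = DobrushinDomain.unitDisc.arc 0 := rfl
/-- "Dual-wired arc" of the far-arc data: the far point. [folklore] -/
@[simp] theorem farArcData_arcB (δ : ℝ) : (farArcData δ).arcB = {(1000:ℂ)} := rfl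

/-- The discrete dual-wired arc of the far-arc data is empty: every site of `Ω_δ` is within `2`
of the boundary point `1 ∈ ∂𝔻 ∖ {1000}` and farther than `999` from `1000`. [folklore] -/
theorem farArcData_zdArcB (δ : ℝ) : (farArcData δ).zdArcB = ∅ := by
  ext x
  simp only [Set.mem_empty_iff_false, iff_false]
  intro hx
  have hx' : x ∈ (farArcData δ).zdDiscreteArc {(1000:ℂ)} := hx
  rw [DiscreteDobrushin.mem_zdDiscreteArc_iff] at hx'
  obtain ⟨hxb, hle⟩ := hx'
  simp only [farArcData_δ, farArcData_Ω, Metric.infDist_singleton] at hle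
  have hxΩ : meshPoint δ x ∈ Metric.ball (0:ℂ) 1 :=
    meshDomain_subset_meshVertices _ _ ((farArcData δ).zdBoundary_subset_meshDomain hxb)
  have hp : ‖meshPoint δ x‖ < 1 := by simpa using hxΩ
  have h1 : (1:ℂ) ∈ frontier (Metric.ball (0:ℂ) 1) \ {(1000:ℂ)} := by
    refine ⟨?_, by norm_num⟩
    rw [frontier_ball (0:ℂ) one_ne_zero]
    simp
  have h2 : Metric.infDist (meshPoint δ x) (frontier (Metric.ball (0:ℂ) 1) \ {(1000:ℂ)}) ≤
      dist (meshPoint δ x) 1 := Metric.infDist_le_dist_of_mem h1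
  have h3 : dist (meshPoint δ x) (1:ℂ) ≤ ‖meshPoint δ x‖ + ‖(1:ℂ)‖ := by
    rw [dist_eq_norm]; exact norm_sub_le _ _
  have h4 : ‖(1000:ℂ)‖ - ‖meshPoint δ x‖ ≤ dist (meshPoint δ x) (1000:ℂ) := by
    rw [dist_comm, dist_eq_norm]; exact norm_sub_norm_le _ _
  have h5 : ‖(1000:ℂ)‖ = 1000 := by
    rw [show (1000:ℂ) = ((1000:ℝ) : ℂ) by norm_num, Complex.norm_real]; norm_num
  rw [h5] at h4
  rw [norm_one] at h3
  linarith

/-- Hence the far-arc data have no `A`–`B` edge. [folklore] -/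
theorem farArcData_zdABEdges (δ : ℝ) : (farArcData δ).zdABEdges = ∅ := by
  ext e
  simp [DiscreteDobrushin.mem_zdABEdges_iff, farArcData_zdArcB]

/-- Hence no exploration path: `medialExploration` is the junk value `[]`. [folklore] -/
theorem medialExploration_farArcData (δ : ℝ) (ω : BondConfig (Site 2)) :
    medialExploration (farArcData δ) ω = [] := by
  rcases medialExploration_eq_nil_or (farArcData δ) ω with h | h
  · exact h
  · exfalso
    have := h.head_mem
    rw [farArcData_zdABEdges] at this
    exact this

/-- Hence the exploration curve is the junk constant curve `0`. [folklore] -/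
theorem medialExplorationCurve_farArcData (δ : ℝ) (ω : BondConfig (Site 2)) :
    medialExplorationCurve (farArcData δ) ω = ContinuousMap.const _ 0 := by
  rw [medialExplorationCurve, medialExploration_farArcData, List.map_nil, polyline_nil]

/-- Hence the interface functional of the conclusion ends at `0`, for every mesh and every
configuration. [folklore] -/
theorem target_iface_farArcData (δ : ℝ) (ω : BondConfig (Site 2)) :
    (iface DobrushinDomain.unitDisc (farArcData δ) ω).target = 0 := by
  unfold iface
  rw [medialExplorationCurve_farArcData]
  split_ifs <;> rfl

/-- The pre-Wiener measure is a probability measure (Kolmogorov extension, proved in the tree). [folklore] -/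
theorem isProbabilityMeasure_preWiener :
    IsProbabilityMeasure Literature.Probability.Process.preWienerMeasure :=
  Literature.Probability.Process.isProbabilityMeasure_preWienerMeasure
    (Literature.Probability.Process.isProjectiveLimit_preWienerMeasure_of
      Literature.Probability.Process.exists_isProjectiveLimit_holds)

/-- An SLE_κ random curve in `(D; a, b)` ends at `b` almost surely (the compactified image is
pinned to `b` at time `1`). [cite: Lawler2005, §6.3] -/
theorem target_ae_of_isSLECurve {κ : ℝ≥0} {D : DobrushinDomain} {Γ : (ℝ≥0 → ℝ) → CurveClass ℂ}
    (h : IsSLECurve κ D Γ) :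
    ∀ᵐ ω ∂Literature.Probability.Process.preWienerMeasure, (Γ ω).target = D.pt 1 := by
  obtain ⟨-, φ, -, hae⟩ := h
  filter_upwards [hae] with ω hω
  obtain ⟨-, c, hc, hcomp⟩ := hω
  rw [hc, CurveClass.target_mk]
  exact hcomp.2

/-- **`ConvergesInLawToSLE` has teeth**: it fails whenever the interfaces have, at every positive
mesh, a deterministic endpoint different from `b` (test function `min 1 (dist (target ·) t₀)`,
endpoint functional `1`-Lipschitz, SLE curve ends at `b` a.s., pre-Wiener measure a probability
measure). [folklore] -/
theorem not_convergesInLawToSLE_of_target_eq {Ωδ : ℝ → Type*} [∀ δ, MeasurableSpace (Ωδ δ)]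
    {X : ∀ δ, Ωδ δ → CurveClass ℂ} {P : ∀ δ, Measure (Ωδ δ)} [∀ δ, IsProbabilityMeasure (P δ)]
    {κ : ℝ≥0} {D : DobrushinDomain} {t₀ : ℂ} (ht : t₀ ≠ D.pt 1)
    (hX : ∀ δ, 0 < δ → ∀ ω, (X δ ω).target = t₀) : ¬ ConvergesInLawToSLE κ D X P := by
  rintro ⟨Γ, hΓ, -, hlaw⟩
  haveI := isProbabilityMeasure_preWiener
  have hcont : Continuous fun q : CurveClass ℂ => min 1 (dist q.target t₀) :=
    continuous_const.min (CurveClass.lipschitzWith_target.continuous.dist continuous_const)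
  have hbd : ∀ p q : CurveClass ℂ,
      dist ((⟨_, hcont⟩ : C(CurveClass ℂ, ℝ)) p) ((⟨_, hcont⟩ : C(CurveClass ℂ, ℝ)) q) ≤ 1 := by
    intro p q
    simp only [ContinuousMap.coe_mk, Real.dist_eq]
    have hp0 : 0 ≤ min 1 (dist p.target t₀) := le_min zero_le_one dist_nonneg
    have hp1 : min 1 (dist p.target t₀) ≤ 1 := min_le_left _ _
    have hq0 : 0 ≤ min 1 (dist q.target t₀) := le_min zero_le_one dist_nonneg
    have hq1 : min 1 (dist q.target t₀) ≤ 1 := min_le_left _ _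
    rw [abs_le]; constructor <;> linarith
  set g : BoundedContinuousFunction (CurveClass ℂ) ℝ :=
    BoundedContinuousFunction.mkOfBound ⟨_, hcont⟩ 1 hbd with hg
  have hgap : ∀ q : CurveClass ℂ, g q = min 1 (dist q.target t₀) := fun q => rfl
  -- lattice side: the integrals vanish at every positive mesh
  have h1 : ∀ δ, 0 < δ → ∫ ω, g (X δ ω) ∂P δ = 0 := by
    intro δ hδ
    simp [hgap, hX δ hδ]
  -- SLE side: the integral is the positive constant `m`
  set m : ℝ := min 1 (dist (D.pt 1) t₀) with hm
  have hmpos : 0 < m := lt_min one_pos (dist_pos.2 ht.symm)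
  have h2 : ∫ ω, g (Γ ω) ∂Literature.Probability.Process.preWienerMeasure = m := by
    have hae : (fun ω => g (Γ ω)) =ᵐ[Literature.Probability.Process.preWienerMeasure] fun _ => m := by
      filter_upwards [target_ae_of_isSLECurve hΓ] with ω hω
      rw [hgap, hω]
    rw [integral_congr_ae hae]
    simp
  have h3 : Tendsto (fun δ : ℝ => ∫ ω, g (X δ ω) ∂P δ) (𝓝[>] (0:ℝ)) (𝓝 m) := h2 ▸ hlaw g
  have h4 : Tendsto (fun _ : ℝ => (0:ℝ)) (𝓝[>] (0:ℝ)) (𝓝 m) :=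
    h3.congr' (eventually_nhdsWithin_of_forall fun δ hδ => h1 δ hδ)
  have h5 : m = 0 := tendsto_nhds_unique h4 tendsto_const_nhds
  exact hmpos.ne' h5

/-- `b = -1 ≠ 0` for the library's unit-disc Dobrushin domain (its marked points lie on the unit
circle). [folklore] -/
theorem unitDisc_pt_one_ne_zero : DobrushinDomain.unitDisc.pt 1 ≠ 0 := by
  have h := DobrushinDomain.unitDisc.pt_mem_frontier 1
  change DobrushinDomain.unitDisc.pt 1 ∈ frontier (Metric.ball (0:ℂ) 1) at h
  rw [frontier_ball (0:ℂ) one_ne_zero] at h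
  intro h0
  rw [h0] at h
  simp at h

/-- **S1 refuted.** Without eventual admissibility (and dual-arc / marks convergence) the
conclusion of the crux is false: witness the far-arc junk family on the unit disc. [folklore] -/
theorem not_conclusionWithoutAdmissibility : ¬ ConclusionWithoutAdmissibility := by
  intro h
  have key := h DobrushinDomain.unitDisc farArcData (fun _ => rfl) (fun _ => rfl) (by
    simp only [farArcData_arcA, Metric.hausdorffEDist_self]
    exact tendsto_const_nhds)
  exact not_convergesInLawToSLE_of_target_eq (t₀ := 0) unitDisc_pt_one_ne_zero.symm
    (fun δ _ ω => target_iface_farArcData δ ω) key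

/-! ## 4′. Refuted strengthening S1′: converging arcs do not prevent junk -/

/-- The lower half circle `(ba)` pushed out to radius `1 + δ`. [folklore] -/
def scaledArc (δ : ℝ) : Set ℂ := (fun z : ℂ => ((1 + δ : ℝ) : ℂ) * z) '' (DobrushinDomain.unitDisc.arc 1)

/-- Points of the unit-disc arcs have norm `1`. [folklore] -/
theorem norm_eq_one_of_mem_arc {z : ℂ} {i : Fin 2} (hz : z ∈ DobrushinDomain.unitDisc.arc i) : ‖z‖ = 1 := by
  have h := DobrushinDomain.unitDisc.arc_subset_frontier i hz
  change z ∈ frontier (Metric.ball (0:ℂ) 1) at h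
  rw [frontier_ball (0:ℂ) one_ne_zero] at h
  simpa using h

/-- Points of the scaled arc have norm `1 + δ`. [folklore] -/
theorem norm_of_mem_scaledArc {δ : ℝ} (hδ : 0 ≤ δ) {w : ℂ} (hw : w ∈ scaledArc δ) : ‖w‖ = 1 + δ := by
  obtain ⟨z, hz, rfl⟩ := hw
  rw [norm_mul, norm_eq_one_of_mem_arc hz, mul_one, Complex.norm_real, Real.norm_eq_abs,
    abs_of_nonneg (by linarith)]

/-- The scaled arc is nonempty. [folklore] -/
theorem scaledArc_nonempty (δ : ℝ) : (scaledArc δ).Nonempty :=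
  ⟨_, DobrushinDomain.unitDisc.pt 1, DobrushinDomain.unitDisc.pt_mem_arc_self 1, rfl⟩

/-- An interior point of the disc is within `1 - ‖p‖` of the unit circle minus any set avoiding
the circle (radial projection). [folklore] -/
theorem infDist_sphere_diff_le {p : ℂ} (hp : ‖p‖ < 1) {S : Set ℂ} (hS : ∀ w ∈ S, ‖w‖ ≠ 1) :
    Metric.infDist p (Metric.sphere (0:ℂ) 1 \ S) ≤ 1 - ‖p‖ := by
  by_cases hp0 : p = 0
  · subst hp0
    have h1 : (1:ℂ) ∈ Metric.sphere (0:ℂ) 1 \ S := ⟨by simp, fun h => hS 1 h (by simp)⟩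
    have h2 := Metric.infDist_le_dist_of_mem (x := (0:ℂ)) h1
    simpa using h2
  · have hnp : (0:ℝ) < ‖p‖ := norm_pos_iff.2 hp0
    set q : ℂ := ((‖p‖⁻¹ : ℝ) : ℂ) * p with hq
    have hqn : ‖q‖ = 1 := by
      rw [hq, norm_mul, Complex.norm_real, Real.norm_eq_abs, abs_of_pos (inv_pos.2 hnp),
        inv_mul_cancel₀ hnp.ne']
    have hqmem : q ∈ Metric.sphere (0:ℂ) 1 \ S := ⟨by simpa using hqn, fun h => hS q h hqn⟩
    have hdist : dist p q = 1 - ‖p‖ := by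
      rw [dist_eq_norm, hq]
      have : p - ((‖p‖⁻¹ : ℝ) : ℂ) * p = ((1 - ‖p‖⁻¹ : ℝ) : ℂ) * p := by push_cast; ring
      rw [this, norm_mul, Complex.norm_real, Real.norm_eq_abs]
      have h1 : 1 - ‖p‖⁻¹ ≤ 0 := by
        rw [sub_nonpos]
        exact one_le_inv_iff₀.2 ⟨hnp, hp.le⟩
      rw [abs_of_nonpos h1]
      field_simp
      ring
    calc Metric.infDist p (Metric.sphere (0:ℂ) 1 \ S) ≤ dist p q := Metric.infDist_le_dist_of_mem hqmem
      _ = 1 - ‖p‖ := hdist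

/-- For `δ > 0` the discrete dual-wired arc of the scaled-arc data is EMPTY: every site of `Ω_δ`
is strictly closer to the unit circle than to the scaled arc. [folklore] -/
theorem zdArcB_scaled_eq_empty {δ : ℝ} (hδ : 0 < δ) :
    (⟨Metric.ball (0:ℂ) 1, δ, DobrushinDomain.unitDisc.arc 0, scaledArc δ⟩ : DiscreteDobrushin).zdArcB = ∅ := by
  ext x
  simp only [Set.mem_empty_iff_false, iff_false]
  intro hx
  have hx' : x ∈ DiscreteDobrushin.zdDiscreteArc ⟨Metric.ball (0:ℂ) 1, δ, DobrushinDomain.unitDisc.arc 0, scaledArc δ⟩ (scaledArc δ) := hx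
  rw [DiscreteDobrushin.mem_zdDiscreteArc_iff] at hx'
  obtain ⟨hxb, hle⟩ := hx'
  change Metric.infDist (meshPoint δ x) (scaledArc δ) ≤
    Metric.infDist (meshPoint δ x) (frontier (Metric.ball (0:ℂ) 1) \ scaledArc δ) at hle
  have hxΩ : meshPoint δ x ∈ Metric.ball (0:ℂ) 1 :=
    meshDomain_subset_meshVertices _ _ (DiscreteDobrushin.zdBoundary_subset_meshDomain _ hxb)
  have hp : ‖meshPoint δ x‖ < 1 := by simpa using hxΩ
  have hS : ∀ w ∈ scaledArc δ, ‖w‖ ≠ 1 := fun w hw => by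
    rw [norm_of_mem_scaledArc hδ.le hw]; linarith
  rw [frontier_ball (0:ℂ) one_ne_zero] at hle
  have h1 := infDist_sphere_diff_le hp hS
  have h2 : 1 + δ - ‖meshPoint δ x‖ ≤ Metric.infDist (meshPoint δ x) (scaledArc δ) := by
    rw [Metric.le_infDist (scaledArc_nonempty δ)]
    intro w hw
    have := norm_sub_norm_le w (meshPoint δ x)
    rw [norm_of_mem_scaledArc hδ.le hw] at this
    rw [dist_comm, dist_eq_norm]; linarith
  linarith

/-- The scaled arc is within Hausdorff distance `δ` of `(ba)`. [folklore] -/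
theorem hausdorffEDist_scaledArc_le {δ : ℝ} (hδ : 0 ≤ δ) :
    Metric.hausdorffEDist (scaledArc δ) (DobrushinDomain.unitDisc.arc 1) ≤ ENNReal.ofReal δ := by
  apply Metric.hausdorffEDist_le_of_mem_edist
  · rintro _ ⟨z, hz, rfl⟩
    refine ⟨z, hz, ?_⟩
    rw [edist_dist]
    apply ENNReal.ofReal_le_ofReal
    rw [dist_eq_norm, show ((1 + δ : ℝ) : ℂ) * z - z = ((δ:ℝ):ℂ) * z by push_cast; ring, norm_mul,
      norm_eq_one_of_mem_arc hz, mul_one, Complex.norm_real, Real.norm_eq_abs, abs_of_nonneg hδ]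
  · intro z hz
    refine ⟨_, ⟨z, hz, rfl⟩, ?_⟩
    rw [edist_dist]
    apply ENNReal.ofReal_le_ofReal
    rw [dist_comm, dist_eq_norm, show ((1 + δ : ℝ) : ℂ) * z - z = ((δ:ℝ):ℂ) * z by push_cast; ring, norm_mul,
      norm_eq_one_of_mem_arc hz, mul_one, Complex.norm_real, Real.norm_eq_abs, abs_of_nonneg hδ]

/-- Hence the scaled arcs converge to `(ba)`. [folklore] -/
theorem tendsto_hausdorffEDist_scaledArc :
    Tendsto (fun δ : ℝ => Metric.hausdorffEDist (scaledArc δ) (DobrushinDomain.unitDisc.arc 1))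
      (𝓝[>] (0:ℝ)) (𝓝 0) := by
  have h0 : Tendsto (fun δ : ℝ => ENNReal.ofReal δ) (𝓝[>] (0:ℝ)) (𝓝 0) := by
    have : Tendsto (fun δ : ℝ => ENNReal.ofReal δ) (𝓝 (0:ℝ)) (𝓝 (ENNReal.ofReal 0)) :=
      ENNReal.tendsto_ofReal tendsto_id
    rw [ENNReal.ofReal_zero] at this
    exact this.mono_left nhdsWithin_le_nhds
  refine tendsto_of_tendsto_of_tendsto_of_le_of_le' tendsto_const_nhds h0
    (Eventually.of_forall fun δ => bot_le) ?_
  filter_upwards [self_mem_nhdsWithin] with δ hδ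
  exact hausdorffEDist_scaledArc_le (le_of_lt hδ)

/-- The scaled-arc junk data at mesh `δ`: wired arc `(ab)`, dual-wired arc the scaled `(ba)`. [folklore] -/
def scaledArcData (δ : ℝ) : DiscreteDobrushin :=
  ⟨Metric.ball (0:ℂ) 1, δ, DobrushinDomain.unitDisc.arc 0, scaledArc δ⟩

/-- For `δ > 0` the scaled-arc data have no `A`–`B` edge. [folklore] -/
theorem scaledArcData_zdABEdges {δ : ℝ} (hδ : 0 < δ) : (scaledArcData δ).zdABEdges = ∅ := by
  ext e
  simp [DiscreteDobrushin.mem_zdABEdges_iff, scaledArcData, zdArcB_scaled_eq_empty hδ]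

/-- Hence no exploration path for `δ > 0`. [folklore] -/
theorem medialExploration_scaledArcData {δ : ℝ} (hδ : 0 < δ) (ω : BondConfig (Site 2)) :
    medialExploration (scaledArcData δ) ω = [] := by
  rcases medialExploration_eq_nil_or (scaledArcData δ) ω with h | h
  · exact h
  · exfalso
    have := h.head_mem
    rw [scaledArcData_zdABEdges hδ] at this
    exact this

/-- Hence the interface functional ends at `0` for every `δ > 0`. [folklore] -/
theorem target_iface_scaledArcData {δ : ℝ} (hδ : 0 < δ) (ω : BondConfig (Site 2)) :
    (iface DobrushinDomain.unitDisc (scaledArcData δ) ω).target = 0 := by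
  unfold iface
  rw [medialExplorationCurve, medialExploration_scaledArcData hδ, List.map_nil, polyline_nil]
  split_ifs <;> rfl

/-- STRENGTHENING S1′ — the conclusion with BOTH arc conditions kept (carrier, mesh, `arcA →
(ab)`, `arcB → (ba)`) and only the marks convergence and eventual admissibility dropped. [folklore] -/
def ConclusionWithoutMarksAndAdmissibility : Prop :=
  ∀ (D : DobrushinDomain) (Λ : ℝ → DiscreteDobrushin), (∀ δ, (Λ δ).Ω = D.carrier) →
    (∀ δ, (Λ δ).δ = δ) →
    Tendsto (fun δ : ℝ => Metric.hausdorffEDist (Λ δ).arcA (D.arc 0)) (𝓝[>] (0:ℝ)) (𝓝 0) →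
    Tendsto (fun δ : ℝ => Metric.hausdorffEDist (Λ δ).arcB (D.arc 1)) (𝓝[>] (0:ℝ)) (𝓝 0) →
    ConvergesInLawToSLE 6 D (Ωδ := fun _ => BondConfig (Site 2)) (fun δ ω => iface D (Λ δ) ω)
      (fun _ => bondPercolation (zdGraph 2) half)

/-- **S1′ refuted**: even with both arcs converging to `(ab)`, `(ba)` in Hausdorff distance, the
conclusion is FALSE without eventual admissibility (and marks convergence): the scaled-arc family
has converging arcs but an empty discrete arc `B` at every positive mesh, hence a junk constant
interface. So arc convergence does not control the discrete arcs; the load-bearing pair of inner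
side conditions is {marks convergence, eventual admissibility}. [folklore] -/
theorem not_conclusionWithoutMarksAndAdmissibility : ¬ ConclusionWithoutMarksAndAdmissibility := by
  intro h
  have key := h DobrushinDomain.unitDisc scaledArcData (fun _ => rfl) (fun _ => rfl) (by
    simp only [scaledArcData, Metric.hausdorffEDist_self]
    exact tendsto_const_nhds) (by
    simp only [scaledArcData]
    exact tendsto_hausdorffEDist_scaledArc)
  exact not_convergesInLawToSLE_of_target_eq (t₀ := 0) unitDisc_pt_one_ne_zero.symm
    (fun δ hδ ω => target_iface_scaledArcData hδ ω) key

/-! ## 5. Consolidation with the sibling crux `ParafermionPrecompact` (stmt-11293): `WeakHolomorphy`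
is not load-bearing, the crux is `¬H → conjecture`, and it HOLDS modulo the open lower bound `H`

Uses the landed negative lemmas of `refuter-cdisprove-stmt-CriticalPhenomena-11293-0`
(`Theorems/ParafermionPrecompact/Negative/ParafermionPrecompactFalseOfBulkNondegenerate.lean`,
`…/WeakSumControl.lean`): `parafermionPrecompact_iff_not_bulkNondegenerate`
(`ParafermionPrecompact ↔ ¬ParafermionBulkNondegenerate`, `H := ParafermionBulkNondegenerate` =
ONE admissible family with `limsup δ^{-1/3} sup_K ‖F_δ‖ > 0`, the weakest consequence of DCS 2012
Conj. 8.7, arXiv:1109.1549 p. 36) and `parafermionPrecompact_false_of_not_weakHolomorphy` (as typed,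
`ParafermionPrecompact → WeakHolomorphy`). -/

section Consolidation

open Summit.CriticalPhenomena.CardyFormulaZ2.Theorems.ParafermionPrecompact.Negative
  (parafermionPrecompact_false_of_not_weakHolomorphy parafermionPrecompact_iff_not_bulkNondegenerate)

/-- **`WeakHolomorphy` is NOT load-bearing in the typed crux**: `crux ↔ (ParafermionPrecompact →
AllFamiliesSLE6)`. [folklore] -/
theorem crux_iff_precompact_imp : ParafermionFamiliesToSLESix ↔ (ParafermionPrecompact → AllFamiliesSLE6) := by
  refine ⟨fun h hP => h ?_ hP, fun h _ hP => h hP⟩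
  by_contra hW
  exact parafermionPrecompact_false_of_not_weakHolomorphy hW hP

/-- **The typed crux is `¬H → conjecture`.** [folklore] -/
theorem crux_iff_not_bulkNondegenerate_imp :
    ParafermionFamiliesToSLESix ↔ (¬ ParafermionBulkNondegenerate →
      Summit.CriticalPhenomena.CardyFormulaZ2.SLE6LimitZ2AllDiscretisations) := by
  rw [crux_iff_precompact_imp, parafermionPrecompact_iff_not_bulkNondegenerate,
    allFamiliesSLE6_iff_conjecture]

/-- **Sharpened refutation shape**: `¬crux ↔ ¬H ∧ ¬conjecture`. A kill must prove that the DCS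
normalisation degenerates for EVERY domain and admissible family (`¬ParafermionBulkNondegenerate`, an
open two-sided bulk estimate, believed FALSE) AND that Smirnov's Conjecture 4 at `q = 1` fails along
some admissible family (believed FALSE). This is why the crux resists. [folklore] -/
theorem not_crux_iff' :
    ¬ ParafermionFamiliesToSLESix ↔ (¬ ParafermionBulkNondegenerate ∧
      ¬ Summit.CriticalPhenomena.CardyFormulaZ2.SLE6LimitZ2AllDiscretisations) := by
  rw [crux_iff_not_bulkNondegenerate_imp, Classical.not_imp]

/-- **The typed crux HOLDS modulo `H`** (positive, conditional, junk): in the Duminil-Copin–Smirnov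
world (`ParafermionBulkNondegenerate`, implied by Conj. 8.7) the hypothesis `ParafermionPrecompact`
is false and the crux is vacuously true. Not landable by a refuter and worthless for the route (the
same `H` refutes the route's rank-3 crux 11293): it certifies that the item must be RESTATED (edge
guards in 11293, twin 11389), not proved. [folklore] -/
theorem crux_of_bulkNondegenerate (hH : ParafermionBulkNondegenerate) : ParafermionFamiliesToSLESix :=
  crux_iff_precompact_imp.2 fun hP => absurd hH (parafermionPrecompact_iff_not_bulkNondegenerate.1 hP)

/-- Equivalently: the typed crux is provable iff `H ∨ conjecture`. [folklore] -/
theorem crux_iff_bulkNondegenerate_or_conjecture :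
    ParafermionFamiliesToSLESix ↔ (ParafermionBulkNondegenerate ∨
      Summit.CriticalPhenomena.CardyFormulaZ2.SLE6LimitZ2AllDiscretisations) := by
  rw [crux_iff_not_bulkNondegenerate_imp]
  tauto

end Consolidation

/-! ## 6. The vanishing world: the typed crux, and its edge-guarded repair, are then the bare
conjecture — non-degeneracy is absent from the hypotheses and cannot be bypassed -/

section VanishingWorld

open Summit.CriticalPhenomena.CardyFormulaZ2.Theorems.ParafermionPrecompact.Negative
  (F IsFamily VanishesOn dbarWeight weakSum_tendsto_zero_of_vanishesOn ClauseBoundEdges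
   ClauseEquicontEdges)

/-- `Vanishing` in the sibling disprover's vocabulary (`IsFamily`, `VanishesOn`). [folklore] -/
theorem vanishing_iff_vanishesOn :
    Vanishing ↔ ∀ (D : DobrushinDomain) (Λ : ℝ → DiscreteDobrushin), IsFamily D Λ →
      ∀ K : Set ℂ, IsCompact K → K ⊆ D.carrier → VanishesOn Λ K := by
  constructor
  · intro h D Λ hΛ K hK hKD
    exact h D Λ hΛ.1 hΛ.2.1 hΛ.2.2.1 hΛ.2.2.2.1 hΛ.2.2.2.2.1 hΛ.2.2.2.2.2 K hK hKD
  · intro h D Λ h1 h2 h3 h4 h5 h6 K hK hKD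
    exact h D Λ ⟨h1, h2, h3, h4, h5, h6⟩ K hK hKD

/-- **`Vanishing → WeakHolomorphy`**: the degenerate normalisation kills the weak-holomorphy sums
(`2/δ²` medial vertices per unit area times `o(δ^{1/3})` times `δ^{5/3}` is `o(1)`; sibling lemma
`weakSum_tendsto_zero_of_vanishesOn`). So the route's rank-2 "open-problem" crux X1 holds for free
in the vanishing world. [folklore] -/
theorem weakHolomorphy_of_vanishing (hV : Vanishing) : WeakHolomorphy := by
  rw [vanishing_iff_vanishesOn] at hV
  intro D Λ h1 h2 h3 h4 h5 h6 φ hφ hsupp hsub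
  exact weakSum_tendsto_zero_of_vanishesOn hφ hsupp
    (hV D Λ ⟨h1, h2, h3, h4, h5, h6⟩ _ hsupp.isCompact hsub)

/-- `Vanishing → ParafermionPrecompact` (as typed; cycle 1). [folklore] -/
theorem parafermionPrecompact_of_vanishing (hV : Vanishing) : ParafermionPrecompact :=
  parafermionPrecompact_iff_vanishing.2 hV

/-- **In the vanishing world the typed crux IS Smirnov's conjecture**: both by-name hypotheses
hold there, so `ParafermionFamiliesToSLESix ↔ SLE6LimitZ2AllDiscretisations`. [folklore] -/
theorem crux_iff_conjecture_of_vanishing (hV : Vanishing) :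
    ParafermionFamiliesToSLESix ↔ Summit.CriticalPhenomena.CardyFormulaZ2.SLE6LimitZ2AllDiscretisations := by
  rw [crux_iff, allFamiliesSLE6_iff_conjecture]
  exact ⟨fun h => h (weakHolomorphy_of_vanishing hV) hV, fun h _ _ => h⟩

/-- Negative packaging: in the vanishing world a failure of the conjecture refutes the crux, and
nothing else can. [folklore] -/
theorem crux_false_of_vanishing_of_not_conjecture (hV : Vanishing)
    (hC : ¬ Summit.CriticalPhenomena.CardyFormulaZ2.SLE6LimitZ2AllDiscretisations) :
    ¬ ParafermionFamiliesToSLESix :=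
  fun h => hC ((crux_iff_conjecture_of_vanishing hV).1 h)

/-! ### The edge-guarded twin `CardyComplexCone.ParafermionToSLESixFamilies` (stmt-11389) — the
announced repair shape of this crux — has the same defect: its hypotheses follow from vanishing -/

/-- The twin's family class: carrier, mesh and eventual admissibility only (no arc or marks
convergence). [folklore] -/
def IsLooseFamily (D : DobrushinDomain) (Λ : ℝ → DiscreteDobrushin) : Prop :=
  (∀ δ, (Λ δ).Ω = D.carrier) ∧ (∀ δ, (Λ δ).δ = δ) ∧ ∀ᶠ δ in 𝓝[>] (0:ℝ), (Λ δ).IsZdAdmissible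

/-- Every family is a loose family. [folklore] -/
theorem IsLooseFamily.of_isFamily {D : DobrushinDomain} {Λ : ℝ → DiscreteDobrushin}
    (h : IsFamily D Λ) : IsLooseFamily D Λ :=
  ⟨h.1, h.2.1, h.2.2.2.2.2⟩

/-- **Loose vanishing**: `δ^{-1/3} F_δ → 0` uniformly on compacts along every LOOSE family (the
degenerate-normalisation world for the twin's family class). [folklore] -/
def LooseVanishing : Prop :=
  ∀ (D : DobrushinDomain) (Λ : ℝ → DiscreteDobrushin), IsLooseFamily D Λ →
    ∀ K : Set ℂ, IsCompact K → K ⊆ D.carrier → VanishesOn Λ K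

/-- Loose vanishing implies vanishing. [folklore] -/
theorem vanishing_of_looseVanishing (h : LooseVanishing) : Vanishing := by
  rw [vanishing_iff_vanishesOn]
  exact fun D Λ hΛ => h D Λ (IsLooseFamily.of_isFamily hΛ)

/-- The twin's first hypothesis (family-form weak holomorphy over loose families), verbatim. [folklore] -/
def TwinWeakHolomorphy : Prop :=
  ∀ (D : DobrushinDomain) (Λ : ℝ → DiscreteDobrushin), (∀ δ, (Λ δ).Ω = D.carrier) →
    (∀ δ, (Λ δ).δ = δ) → (∀ᶠ δ in 𝓝[>] (0:ℝ), (Λ δ).IsZdAdmissible) →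
    ∀ (φ : ℂ → ℂ), ContDiff ℝ (⊤ : ℕ∞) φ → HasCompactSupport φ → tsupport φ ⊆ D.carrier →
      Tendsto (fun δ : ℝ => ((δ ^ ((5:ℝ) / 3) : ℝ) : ℂ) * ∑ᶠ z : MedialVertex,
        (∫ ω, MedialPath.passageSum (medialExploration (Λ δ) ω) δ (1 / 3) z
          ∂(bondPercolation (zdGraph 2) half)) *
        ((fderiv ℝ φ (medialPoint δ z) 1 + Complex.I * fderiv ℝ φ (medialPoint δ z) Complex.I) / 2))
        (𝓝[>] (0:ℝ)) (𝓝 0)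

/-- The twin's second hypothesis (edge-guarded precompactness over loose families), verbatim up
to unfolding its `let`. [folklore] -/
def TwinPrecompact : Prop :=
  ∀ (D : DobrushinDomain) (Λ : ℝ → DiscreteDobrushin), (∀ δ, (Λ δ).Ω = D.carrier) →
    (∀ δ, (Λ δ).δ = δ) → (∀ᶠ δ in 𝓝[>] (0:ℝ), (Λ δ).IsZdAdmissible) →
    ∀ K : Set ℂ, IsCompact K → K ⊆ D.carrier → ClauseBoundEdges Λ K ∧ ClauseEquicontEdges Λ K

/-- Read-back of the twin: `ParafermionToSLESixFamilies ↔ (TwinWeakHolomorphy → TwinPrecompact →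
AllFamiliesSLE6)` (definitional). [folklore] -/
theorem twin_iff :
    Summit.CriticalPhenomena.CardyFormulaZ2.Theses.CardyComplexCone.ParafermionToSLESixFamilies ↔
      (TwinWeakHolomorphy → TwinPrecompact → AllFamiliesSLE6) :=
  Iff.rfl

/-- Loose vanishing gives the twin's weak holomorphy. [folklore] -/
theorem twinWeakHolomorphy_of_looseVanishing (hV : LooseVanishing) : TwinWeakHolomorphy := by
  intro D Λ h1 h2 h6 φ hφ hsupp hsub
  exact weakSum_tendsto_zero_of_vanishesOn hφ hsupp (hV D Λ ⟨h1, h2, h6⟩ _ hsupp.isCompact hsub)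

/-- Vanishing on `K` gives the edge-guarded clauses on `K` (bound `C = 1`, triangle inequality).
[folklore] -/
theorem clausesEdges_of_vanishesOn {Λ : ℝ → DiscreteDobrushin} {K : Set ℂ} (h : VanishesOn Λ K) :
    ClauseBoundEdges Λ K ∧ ClauseEquicontEdges Λ K := by
  refine ⟨⟨1, ?_⟩, fun ε hε => ⟨1, one_pos, ?_⟩⟩
  · filter_upwards [h 1 one_pos] with δ hδ z _ hz
    exact hδ z hz
  · filter_upwards [h (ε / 2) (half_pos hε)] with δ hδ z z' _ _ hz hz' _
    calc ‖F Λ δ z - F Λ δ z'‖ ≤ ‖F Λ δ z‖ + ‖F Λ δ z'‖ := norm_sub_le _ _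
      _ ≤ ε / 2 * δ ^ ((1:ℝ) / 3) + ε / 2 * δ ^ ((1:ℝ) / 3) := add_le_add (hδ z hz) (hδ z' hz')
      _ = ε * δ ^ ((1:ℝ) / 3) := by ring

/-- Loose vanishing gives the twin's edge-guarded precompactness. [folklore] -/
theorem twinPrecompact_of_looseVanishing (hV : LooseVanishing) : TwinPrecompact :=
  fun D Λ h1 h2 h6 K hK hKD => clausesEdges_of_vanishesOn (hV D Λ ⟨h1, h2, h6⟩ K hK hKD)

/-- **In the loose-vanishing world the edge-guarded twin IS Smirnov's conjecture, too.** The edge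
guards repair the COLLAPSE of 11293 (the guarded clauses no longer FORCE vanishing) but they do not
EXCLUDE vanishing: no hypothesis of the repaired implication is a non-degeneracy statement, so in
the world `δ^{-1/3}F_δ → 0` the observable carries no information and the item is the bare
conjecture. A proof must therefore either derive non-degeneracy (an open `δ^{1/3}` LOWER bound,
crux NOTES S0/S2) inside the argument, or carry it as an explicit extra hypothesis. [folklore] -/
theorem twin_iff_conjecture_of_looseVanishing (hV : LooseVanishing) :
    Summit.CriticalPhenomena.CardyFormulaZ2.Theses.CardyComplexCone.ParafermionToSLESixFamilies ↔
      Summit.CriticalPhenomena.CardyFormulaZ2.SLE6LimitZ2AllDiscretisations := by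
  rw [twin_iff, allFamiliesSLE6_iff_conjecture]
  exact ⟨fun h => h (twinWeakHolomorphy_of_looseVanishing hV) (twinPrecompact_of_looseVanishing hV),
    fun h _ _ => h⟩

/-- Negative packaging for the twin. [folklore] -/
theorem twin_false_of_looseVanishing_of_not_conjecture (hV : LooseVanishing)
    (hC : ¬ Summit.CriticalPhenomena.CardyFormulaZ2.SLE6LimitZ2AllDiscretisations) :
    ¬ Summit.CriticalPhenomena.CardyFormulaZ2.Theses.CardyComplexCone.ParafermionToSLESixFamilies :=
  fun h => hC ((twin_iff_conjecture_of_looseVanishing hV).1 h)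

/-- **Refutation shape of the repaired form**: `¬twin ↔ TwinWeakHolomorphy ∧ TwinPrecompact ∧
¬conjecture` — as un-killable as the typed crux (a kill needs a counterexample to conformal
invariance of bond percolation on `ℤ²`), but for the honest reason. [folklore] -/
theorem not_twin_iff :
    ¬ Summit.CriticalPhenomena.CardyFormulaZ2.Theses.CardyComplexCone.ParafermionToSLESixFamilies ↔
      TwinWeakHolomorphy ∧ TwinPrecompact ∧
        ¬ Summit.CriticalPhenomena.CardyFormulaZ2.SLE6LimitZ2AllDiscretisations := by
  rw [twin_iff, allFamiliesSLE6_iff_conjecture]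
  simp only [Classical.not_imp]

/-- In the loose-vanishing world the typed crux and its repaired twin coincide (both are the
conjecture). [folklore] -/
theorem crux_iff_twin_of_looseVanishing (hV : LooseVanishing) :
    ParafermionFamiliesToSLESix ↔
      Summit.CriticalPhenomena.CardyFormulaZ2.Theses.CardyComplexCone.ParafermionToSLESixFamilies := by
  rw [crux_iff_conjecture_of_vanishing (vanishing_of_looseVanishing hV),
    twin_iff_conjecture_of_looseVanishing hV]

end VanishingWorld

/-! ## 7. Refuted strengthening S3: the re-orientation of the interface is load-bearing — the H21
exploration of `(ab)`-wired data STARTS AT `b` -/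

section RawOrientation

open UnitDiscDiscretisation
open Literature.Probability.LatticeModels.DiscreteDobrushin (startCorner exitTime
  isStartCorner_startCorner medialExploration_eq_explorationList isInnerFace_of_lt_exitTime
  not_isInnerFace_exitTime exitTime_pos existsUnique_startCorner IsStartCorner)

/-- **`ConvergesInLawToSLE` has teeth, II**: it fails whenever, eventually in the mesh, every
interface ENDS at distance `≥ m > 0` from `b` (test function `min 1 (dist (target ·) b)`; uses the
eventual a.e.-measurability built into the definition, the SLE curve ending at `b` a.s., and that
the `P δ` are probability measures). [folklore] -/
theorem not_convergesInLawToSLE_of_le_dist_target {Ωδ : ℝ → Type*} [∀ δ, MeasurableSpace (Ωδ δ)]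
    {X : ∀ δ, Ωδ δ → CurveClass ℂ} {P : ∀ δ, Measure (Ωδ δ)} [∀ δ, IsProbabilityMeasure (P δ)]
    {κ : ℝ≥0} {D : DobrushinDomain} {m : ℝ} (hm : 0 < m)
    (hX : ∀ᶠ δ in 𝓝[>] (0:ℝ), ∀ ω, m ≤ dist (X δ ω).target (D.pt 1)) :
    ¬ ConvergesInLawToSLE κ D X P := by
  rintro ⟨Γ, hΓ, hmeas, hlaw⟩
  haveI := isProbabilityMeasure_preWiener
  have hcont : Continuous fun q : CurveClass ℂ => min 1 (dist q.target (D.pt 1)) :=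
    continuous_const.min (CurveClass.lipschitzWith_target.continuous.dist continuous_const)
  have hbd : ∀ p q : CurveClass ℂ,
      dist ((⟨_, hcont⟩ : C(CurveClass ℂ, ℝ)) p) ((⟨_, hcont⟩ : C(CurveClass ℂ, ℝ)) q) ≤ 1 := by
    intro p q
    simp only [ContinuousMap.coe_mk, Real.dist_eq]
    have hp0 : 0 ≤ min 1 (dist p.target (D.pt 1)) := le_min zero_le_one dist_nonneg
    have hp1 : min 1 (dist p.target (D.pt 1)) ≤ 1 := min_le_left _ _
    have hq0 : 0 ≤ min 1 (dist q.target (D.pt 1)) := le_min zero_le_one dist_nonneg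
    have hq1 : min 1 (dist q.target (D.pt 1)) ≤ 1 := min_le_left _ _
    rw [abs_le]; constructor <;> linarith
  set g : BoundedContinuousFunction (CurveClass ℂ) ℝ :=
    BoundedContinuousFunction.mkOfBound ⟨_, hcont⟩ 1 hbd with hg
  have hgap : ∀ q : CurveClass ℂ, g q = min 1 (dist q.target (D.pt 1)) := fun q => rfl
  -- SLE side: the integral vanishes
  have h2 : ∫ ω, g (Γ ω) ∂Literature.Probability.Process.preWienerMeasure = 0 := by
    have hae : (fun ω => g (Γ ω)) =ᵐ[Literature.Probability.Process.preWienerMeasure] fun _ => (0:ℝ) := by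
      filter_upwards [target_ae_of_isSLECurve hΓ] with ω hω
      rw [hgap, hω, dist_self]
      simp
    rw [integral_congr_ae hae]
    simp
  -- lattice side: eventually the integral is at least `min 1 m`
  set m' : ℝ := min 1 m with hm'
  have hm'pos : 0 < m' := lt_min one_pos hm
  have h1 : ∀ᶠ δ in 𝓝[>] (0:ℝ), m' ≤ ∫ ω, g (X δ ω) ∂P δ := by
    filter_upwards [hX, hmeas] with δ hδ hmeasδ
    have hint : Integrable (fun ω => g (X δ ω)) (P δ) := by
      refine Integrable.of_bound (C := 1) ?_ ?_
      · exact (g.continuous.measurable.comp_aemeasurable hmeasδ).aestronglyMeasurable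
      · exact Eventually.of_forall fun ω => by
          rw [hgap, Real.norm_eq_abs, abs_of_nonneg (le_min zero_le_one dist_nonneg)]
          exact min_le_left _ _
    have hle : ∀ ω, m' ≤ g (X δ ω) := fun ω => by
      rw [hgap]
      exact min_le_min le_rfl (hδ ω)
    calc m' = ∫ _, m' ∂P δ := by simp
      _ ≤ ∫ ω, g (X δ ω) ∂P δ := integral_mono (integrable_const _) hint hle
  have h3 : Tendsto (fun δ : ℝ => ∫ ω, g (X δ ω) ∂P δ) (𝓝[>] (0:ℝ)) (𝓝 0) := h2 ▸ hlaw g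
  have h4 : ∀ᶠ δ in 𝓝[>] (0:ℝ), ∫ ω, g (X δ ω) ∂P δ < m' :=
    h3 (Iio_mem_nhds hm'pos)
  obtain ⟨δ, hδ1, hδ2⟩ := (h1.and h4).exists
  exact absurd hδ2 (not_lt.2 hδ1)

variable {δ : ℝ}

/-- The start corner of the tilted unit-disc data: vertex `(-M, 0)` (on the arc `A`), direction
`3` (south, towards `(-M, -1)` on the arc `B`); its source edge is the LEFT `A`–`B` edge `eL`,
at the discrete marked point `b_δ ≈ -1`. [folklore] -/
def startL (δ : ℝ) : Site 2 × Fin 4 := ((![-(abCol δ : ℤ), 0] : Site 2), 3)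

theorem startL_fst (δ : ℝ) : (startL δ).1 = ![-(abCol δ : ℤ), 0] := rfl
theorem startL_snd (δ : ℝ) : (startL δ).2 = 3 := rfl

theorem startL_fst_add_cornerUnit (δ : ℝ) :
    (startL δ).1 + cornerUnit (startL δ).2 = ![-(abCol δ : ℤ), -1] := by
  ext i; fin_cases i <;> simp [startL, cornerUnit]

theorem faceAt_startL (δ : ℝ) : faceAt (startL δ).1 (startL δ).2 = ![-(abCol δ : ℤ), -1] := by
  ext i; fin_cases i <;> simp [startL, faceAt, cornerOff]

theorem faceAt_startL_add_three (δ : ℝ) :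
    faceAt (startL δ).1 ((startL δ).2 + 3) = ![-(abCol δ : ℤ) - 1, -1] := by
  have h : (startL δ).2 + 3 = 2 := by rw [startL_snd]; decide
  rw [h]
  ext i; fin_cases i <;> simp [startL, faceAt, cornerOff]

/-- The source edge of `startL` is `eL`. [folklore] -/
theorem cSrc_startL (δ : ℝ) : cSrc (startL δ) = eL δ := by
  rw [cSrc, startL_fst_add_cornerUnit, startL_fst, eL]

variable (hδ : 0 < δ) (hδ' : δ < 1 / 2)
include hδ hδ'

/-- `startL` is a start corner of the tilted data (`0 < δ < 1/2`). [folklore] -/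
theorem isStartCorner_startL : (discData δ).IsStartCorner (startL δ) where
  mem_zdArcA := by rw [startL_fst]; exact xL0_mem_zdArcA hδ hδ'
  mem_zdArcB := by rw [startL_fst_add_cornerUnit]; exact xL1_mem_zdArcB hδ hδ'
  isOutEdge := by
    constructor
    · rw [faceAt_startL]; exact isInnerFace_fL hδ hδ'
    · rw [faceAt_startL_add_three]; exact not_isInnerFace_gL hδ hδ'

/-- Hence it is THE start corner. [folklore] -/
theorem startCorner_discData :
    startCorner (isZdAdmissible_discData hδ hδ') = startL δ := by
  have h1 := isStartCorner_startCorner (isZdAdmissible_discData hδ hδ')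
  have h2 := isStartCorner_startL hδ hδ'
  exact (existsUnique_startCorner (isZdAdmissible_discData hδ hδ')).unique
    ⟨h1.mem_zdArcA, h1.mem_zdArcB, h1.isOutEdge⟩ ⟨h2.mem_zdArcA, h2.mem_zdArcB, h2.isOutEdge⟩

/-- **The exploration of the tilted unit-disc data starts at `eL`, i.e. at `b_δ → b = -1`**, for
every configuration. [folklore] -/
theorem head_medialExploration_discData (ω : BondConfig (Site 2)) :
    (medialExploration (discData δ) ω).head? = some (eL δ) := by
  rw [medialExploration_eq_explorationList (isZdAdmissible_discData hδ hδ') ω,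
    List.head?_eq_some_head (explorationList_ne_nil _), head_explorationList,
    startCorner_discData hδ hδ', cSrc_startL]

/-- … and ends at `eR`, i.e. at `a_δ → a = 1`, for every configuration. [folklore] -/
theorem getLast_medialExploration_discData (ω : BondConfig (Site 2)) :
    (medialExploration (discData δ) ω).getLast? = some (eR δ) := by
  have hD := isZdAdmissible_discData hδ hδ'
  rw [medialExploration_eq_explorationList hD ω,
    List.getLast?_eq_some_getLast (explorationList_ne_nil _), getLast_explorationList]
  obtain ⟨N, hN⟩ : ∃ N, exitTime hD ω = N + 1 := ⟨exitTime hD ω - 1, by have := exitTime_pos hD ω; omega⟩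
  rw [hN, cSrc_cornerOrbit_succ]
  have hin : (discData δ).IsInnerFace (cFace (cornerOrbit ((discData δ).bcBondConfig ω)
      (startCorner hD) N)) := isInnerFace_of_lt_exitTime hD ω (by omega)
  have hout : ¬ (discData δ).IsInnerFace (cFace (cornerOrbit ((discData δ).bcBondConfig ω)
      (startCorner hD) (N + 1))) := hN ▸ not_isInnerFace_exitTime hD ω
  have hmem := cTgt_exit_mem_zdABEdges hD (isStartCorner_startCorner hD) hin hout
  have hne := cTgt_exit_ne_cSrc_start hD (isStartCorner_startCorner hD) hin hout
  have hsrc : cSrc (startCorner hD) = eL δ := by rw [startCorner_discData hδ hδ', cSrc_startL]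
  rw [hsrc] at hne
  rw [zdABEdges_discData hδ hδ'] at hmem
  simp only [Set.mem_insert_iff, Set.mem_singleton_iff] at hmem
  rcases hmem with h | h
  · rw [h]
  · exact absurd h hne

omit hδ hδ' in
/-- The first marked point of the unit disc Dobrushin domain is `a = 1`. [folklore] -/
theorem unitDisc_pt_zero : DobrushinDomain.unitDisc.pt 0 = 1 := by
  simp [MarkedDomain.pt, DobrushinDomain.unitDisc, JordanDomain.unitDisc, circleMap]

omit hδ hδ' in
/-- The second marked point of the unit disc Dobrushin domain is `b = -1`. [folklore] -/
theorem unitDisc_pt_one : DobrushinDomain.unitDisc.pt 1 = -1 := by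
  have h : DobrushinDomain.unitDisc.pt 1 = circleMap 0 1 (2 * Real.pi * (1 / 2)) := rfl
  rw [h, circleMap]
  have : ((2 * Real.pi * (1 / 2) : ℝ) : ℂ) * Complex.I = Real.pi * Complex.I := by push_cast; ring
  rw [this, Complex.exp_pi_mul_I]; simp

/-- **The RAW exploration curve of the tilted data ends near `a`, not `b`**: its endpoint is at
distance `≥ 2 - 3δ` from `b = -1`. [folklore] -/
theorem le_dist_target_raw (ω : BondConfig (Site 2)) :
    2 - 3 * δ ≤ dist (CurveClass.mk (⟨medialExplorationCurve (discData δ) ω⟩ : Curve ℂ)).target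
      (DobrushinDomain.unitDisc.pt 1) := by
  rw [CurveClass.target_mk, unitDisc_pt_one]
  change 2 - 3 * δ ≤ dist (medialExplorationCurve (discData δ) ω 1) (-1)
  have hlast := getLast_medialExploration_discData hδ hδ' ω
  obtain ⟨a, l, hal⟩ : ∃ a l, medialExploration (discData δ) ω = a :: l := by
    cases h : medialExploration (discData δ) ω with
    | nil => rw [h] at hlast; simp at hlast
    | cons a l => exact ⟨a, l, rfl⟩
  have hδeq : (discData δ).δ = δ := rfl
  rw [medialExplorationCurve, hal, List.map_cons, polyline_apply_one, hδeq]
  have h1 : ((medialPoint δ a) :: l.map (medialPoint δ)).getLast? = some (medialPoint δ (eR δ)) := by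
    rw [← List.map_cons, List.getLast?_map, ← hal, hlast]; rfl
  rw [List.getLast?_eq_some_getLast (List.cons_ne_nil _ _), Option.some.injEq] at h1
  rw [h1]
  have hR := dist_medialPoint_eR_le hδ hδ'
  have htri : dist (1:ℂ) (-1) ≤ dist (1:ℂ) (medialPoint δ (eR δ)) + dist (medialPoint δ (eR δ)) (-1) :=
    dist_triangle _ _ _
  have h2 : dist (1:ℂ) (-1) = 2 := by
    rw [dist_eq_norm, sub_neg_eq_add, show (1:ℂ) + 1 = ((2:ℝ) : ℂ) by push_cast; norm_num,
      Complex.norm_real]; norm_num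
  rw [dist_comm] at hR
  linarith

/-- STRENGTHENING S3 — the conclusion of the crux stated for the RAW exploration curve (the
re-orientation `if dist (γ 0) a ≤ dist (γ 0) b then γ else γ.reverse` removed). [folklore] -/
def ConclusionRaw : Prop :=
  ∀ (D : DobrushinDomain) (Λ : ℝ → DiscreteDobrushin), (∀ δ, (Λ δ).Ω = D.carrier) →
    (∀ δ, (Λ δ).δ = δ) →
    Tendsto (fun δ : ℝ => Metric.hausdorffEDist (Λ δ).arcA (D.arc 0)) (𝓝[>] (0:ℝ)) (𝓝 0) →
    Tendsto (fun δ : ℝ => Metric.hausdorffEDist (Λ δ).arcB (D.arc 1)) (𝓝[>] (0:ℝ)) (𝓝 0) →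
    Tendsto (fun δ : ℝ => Metric.hausdorffEDist (medialPoint δ '' (Λ δ).zdABEdges) {D.pt 0, D.pt 1})
      (𝓝[>] (0:ℝ)) (𝓝 0) →
    (∀ᶠ δ in 𝓝[>] (0:ℝ), (Λ δ).IsZdAdmissible) →
    ConvergesInLawToSLE 6 D (Ωδ := fun _ => BondConfig (Site 2))
      (fun δ ω => CurveClass.mk (⟨medialExplorationCurve (Λ δ) ω⟩ : Curve ℂ))
      (fun _ => bondPercolation (zdGraph 2) half)

omit hδ hδ' in
/-- **S3 refuted**: along the tree's own admissible discretisation of the unit disc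
(`UnitDiscDiscretisation.discData`: all six family hypotheses hold), the RAW exploration curve does
NOT converge to chordal SLE₆ from `a = 1` to `b = -1`: for EVERY configuration it runs from
`b_δ → -1` to `a_δ → 1` (the H21 exploration keeps the wired arc `A ≈ (ab)` on its LEFT, hence starts
at the `A → B` transition in counter-clockwise order, which is at `b`), so its endpoint stays at
distance `≥ 2 - 3δ` from `b`, while an SLE₆ curve in `(𝔻; 1, -1)` ends at `-1` a.s. Hence the
re-orientation in the crux's conclusion is load-bearing, every admissible `(ab)`-wired family is
explored `b → a` in the tree's conventions, and the conjectured SLE₆ limit of the re-oriented curve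
is the TIME-REVERSAL of the exploration (reversibility of SLE₆ in the continuum). [folklore] -/
theorem not_conclusionRaw : ¬ ConclusionRaw := by
  intro h
  have key := h DobrushinDomain.unitDisc discData isDiscretisation_discData.Ω_eq
    isDiscretisation_discData.δ_eq isDiscretisation_discData.tendsto_arcA
    isDiscretisation_discData.tendsto_arcB isDiscretisation_discData.tendsto_zdABEdges
    isDiscretisation_discData.eventually_isZdAdmissible
  refine not_convergesInLawToSLE_of_le_dist_target (m := 1) one_pos ?_ key
  filter_upwards [Ioo_mem_nhdsGT (show (0:ℝ) < 1 / 3 by norm_num)] with δ hδI ω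
  have := le_dist_target_raw hδI.1 (by linarith [hδI.2]) ω
  linarith [hδI.2]

end RawOrientation

/-! ## 8. The orientation tax: in the tree's conventions the conclusion asks the RAW exploration
(started at `b_δ`) to converge to the TIME-REVERSAL of SLE₆ `a → b`; the bridge to the natural
statement "exploration → SLE₆ from its start `b` to its end `a`" is SLE₆ REVERSIBILITY
(Miller–Sheffield 2016), which is not in the tree -/

section OrientationTax

open UnitDiscDiscretisation

/-- **The re-orientation is a deterministic time reversal**: the `else` branch of the conclusion's
interface functional is `CurveClass.reverse` of the raw exploration class (definitionally,
`Curve.reverse γ = γ ∘ σ`). [folklore] -/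
theorem iface_eq_ite (D : DobrushinDomain) (E : DiscreteDobrushin) (ω : BondConfig (Site 2)) :
    iface D E ω =
      if dist (medialExplorationCurve E ω 0) (D.pt 0) ≤ dist (medialExplorationCurve E ω 0) (D.pt 1)
        then CurveClass.mk (⟨medialExplorationCurve E ω⟩ : Curve ℂ)
        else (CurveClass.mk (⟨medialExplorationCurve E ω⟩ : Curve ℂ)).reverse := by
  unfold iface
  split_ifs <;> rfl

/-- For admissible data the raw exploration curve STARTS at the medial point of the start edge
`e_a = cSrc (startCorner hE)` — the same point for every configuration (sibling
`head_medialExploration`). [folklore] -/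
theorem medialExplorationCurve_zero {E : DiscreteDobrushin} (hE : E.IsZdAdmissible)
    (ω : BondConfig (Site 2)) :
    medialExplorationCurve E ω 0 = medialPoint E.δ (cSrc (DiscreteDobrushin.startCorner hE)) := by
  have hhead := Summit.CriticalPhenomena.CardyFormulaZ2.Theorems.ParafermionPrecompact.Negative.head_medialExploration hE ω
  obtain ⟨a, l, hal⟩ : ∃ a l, medialExploration E ω = a :: l := by
    cases h : medialExploration E ω with
    | nil => rw [h] at hhead; simp at hhead
    | cons a l => exact ⟨a, l, rfl⟩
  rw [hal, List.head?_cons, Option.some.injEq] at hhead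
  rw [medialExplorationCurve, hal, List.map_cons, polyline_apply_zero, hhead]

/-- **The re-orientation branch is deterministic**: for admissible data the `if` of the
conclusion's interface functional tests the position of the START EDGE `e_a` (a datum of `E`)
relative to the marked points — the same branch for every configuration `ω`; the re-oriented
interface is either the raw exploration class for all `ω`, or its time-reversal for all `ω`.
[folklore] -/
theorem iface_eq_ite_startEdge {D : DobrushinDomain} {E : DiscreteDobrushin} (hE : E.IsZdAdmissible)
    (ω : BondConfig (Site 2)) :
    iface D E ω =
      if dist (medialPoint E.δ (cSrc (DiscreteDobrushin.startCorner hE))) (D.pt 0) ≤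
          dist (medialPoint E.δ (cSrc (DiscreteDobrushin.startCorner hE))) (D.pt 1)
        then CurveClass.mk (⟨medialExplorationCurve E ω⟩ : Curve ℂ)
        else (CurveClass.mk (⟨medialExplorationCurve E ω⟩ : Curve ℂ)).reverse := by
  rw [iface_eq_ite, medialExplorationCurve_zero hE ω]

variable {δ : ℝ}

/-- The raw exploration curve of the tilted unit-disc data starts at the discrete marked point
`b_δ = medialPoint δ eL` (for every configuration). [folklore] -/
theorem medialExplorationCurve_discData_zero (hδ : 0 < δ) (hδ' : δ < 1 / 2) (ω : BondConfig (Site 2)) :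
    medialExplorationCurve (discData δ) ω 0 = medialPoint δ (eL δ) := by
  have hhead := head_medialExploration_discData hδ hδ' ω
  obtain ⟨a, l, hal⟩ : ∃ a l, medialExploration (discData δ) ω = a :: l := by
    cases h : medialExploration (discData δ) ω with
    | nil => rw [h] at hhead; simp at hhead
    | cons a l => exact ⟨a, l, rfl⟩
  rw [hal, List.head?_cons, Option.some.injEq] at hhead
  have hδeq : (discData δ).δ = δ := rfl
  rw [medialExplorationCurve, hal, List.map_cons, polyline_apply_zero, hδeq, hhead]

/-- **On the unit-disc family the conclusion's interface IS the reversed exploration**, for every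
mesh `δ ∈ (0, 1/3)` and every configuration: the raw start `b_δ` is within `3δ` of `b = -1`, hence
farther from `a = 1`. [folklore] -/
theorem iface_discData_eq_reverse (hδ : 0 < δ) (hδ3 : δ < 1 / 3) (ω : BondConfig (Site 2)) :
    iface DobrushinDomain.unitDisc (discData δ) ω =
      (CurveClass.mk (⟨medialExplorationCurve (discData δ) ω⟩ : Curve ℂ)).reverse := by
  have hδ' : δ < 1 / 2 := by linarith
  rw [iface_eq_ite, if_neg]
  rw [not_le, unitDisc_pt_zero, unitDisc_pt_one, medialExplorationCurve_discData_zero hδ hδ' ω]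
  have hL := dist_medialPoint_eL_le hδ hδ'
  have htri : dist (1:ℂ) (-1) ≤ dist (1:ℂ) (medialPoint δ (eL δ)) + dist (medialPoint δ (eL δ)) (-1) :=
    dist_triangle _ _ _
  have h2 : dist (1:ℂ) (-1) = 2 := by
    rw [dist_eq_norm, sub_neg_eq_add, show (1:ℂ) + 1 = ((2:ℝ) : ℂ) by push_cast; norm_num,
      Complex.norm_real]; norm_num
  have hc : dist (1:ℂ) (medialPoint δ (eL δ)) = dist (medialPoint δ (eL δ)) 1 := dist_comm _ _
  linarith

/-- Reversal inside a.e.-measurability (time reversal is a measurable involution). [folklore] -/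
theorem aemeasurable_reverse_comp_iff {α : Type*} [MeasurableSpace α] {μ : Measure α}
    {X : α → CurveClass ℂ} :
    AEMeasurable (fun a => (X a).reverse) μ ↔ AEMeasurable X μ := by
  refine ⟨fun h => ?_, fun h => CurveClass.measurable_reverse.comp_aemeasurable h⟩
  have : X = fun a => ((X a).reverse).reverse := by funext a; rw [CurveClass.reverse_reverse]
  rw [this]
  exact CurveClass.measurable_reverse.comp_aemeasurable h

/-- Reversal inside convergence in law (time reversal is a self-inverse isometry, so bounded
continuous test functions pull back to bounded continuous test functions). [folklore] -/
theorem tendstoLaw_reverse_iff {Ωδ : ℝ → Type*} [∀ δ, MeasurableSpace (Ωδ δ)]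
    {X : ∀ δ, Ωδ δ → CurveClass ℂ} {P : ∀ δ, Measure (Ωδ δ)} {Ω' : Type*} [MeasurableSpace Ω']
    {Z : Ω' → CurveClass ℂ} {μ : Measure Ω'} :
    TendstoLaw (fun δ ω => (X δ ω).reverse) P Z μ ↔ TendstoLaw X P (fun ω => (Z ω).reverse) μ := by
  constructor
  · intro h f
    have := h (f.compContinuous ⟨CurveClass.reverse, CurveClass.continuous_reverse⟩)
    simpa [BoundedContinuousFunction.compContinuous_apply] using this
  · intro h f
    have := h (f.compContinuous ⟨CurveClass.reverse, CurveClass.continuous_reverse⟩)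
    simpa [BoundedContinuousFunction.compContinuous_apply] using this

/-- `ConvergesInLawToSLE` only sees the interfaces at small meshes. [folklore] -/
theorem convergesInLawToSLE_congr {Ωδ : ℝ → Type*} [∀ δ, MeasurableSpace (Ωδ δ)]
    {X X' : ∀ δ, Ωδ δ → CurveClass ℂ} {P : ∀ δ, Measure (Ωδ δ)} {κ : ℝ≥0} {D : DobrushinDomain}
    (h : ∀ᶠ δ in 𝓝[>] (0:ℝ), X δ = X' δ) :
    ConvergesInLawToSLE κ D X P ↔ ConvergesInLawToSLE κ D X' P := by
  have hmeas : (∀ᶠ δ in 𝓝[>] (0:ℝ), AEMeasurable (X δ) (P δ)) ↔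
      ∀ᶠ δ in 𝓝[>] (0:ℝ), AEMeasurable (X' δ) (P δ) :=
    Filter.eventually_congr (h.mono fun δ hδ => by rw [hδ])
  have hlaw : ∀ (Γ : (ℝ≥0 → ℝ) → CurveClass ℂ),
      TendstoLaw X P Γ Literature.Probability.Process.preWienerMeasure ↔
        TendstoLaw X' P Γ Literature.Probability.Process.preWienerMeasure := by
    intro Γ
    refine forall_congr' fun f => Filter.tendsto_congr' ?_
    exact h.mono fun δ hδ => by simp only [hδ]
  unfold ConvergesInLawToSLE
  simp only [hmeas, hlaw]

/-- **General form of the orientation bookkeeping, `else` branch.** For any raw interface family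
`Y`, any re-orientation test `c` that eventually FAILS for every configuration, convergence of the
re-oriented family `if c then ⟦Y⟧ else ⟦Y⟧.reverse` to SLE_κ in `D` is EXACTLY convergence of the
raw family to the time-reversal of an SLE_κ in `D`. (With `reorient_eq_ite`/`iface_eq_ite` this is
the shape of the crux's conclusion; the test is ω-independent for admissible data.) [folklore] -/
theorem convergesInLawToSLE_ite_iff_of_eventually_not {Ωδ : ℝ → Type*} [∀ δ, MeasurableSpace (Ωδ δ)]
    {Y : ∀ δ, Ωδ δ → Curve ℂ} {c : ∀ δ, Ωδ δ → Prop} [∀ δ ω, Decidable (c δ ω)]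
    {P : ∀ δ, Measure (Ωδ δ)} {κ : ℝ≥0} {D : DobrushinDomain}
    (h : ∀ᶠ δ in 𝓝[>] (0:ℝ), ∀ ω, ¬ c δ ω) :
    ConvergesInLawToSLE κ D
        (fun δ ω => if c δ ω then CurveClass.mk (Y δ ω) else (CurveClass.mk (Y δ ω)).reverse) P ↔
      ∃ Γ, IsSLECurve κ D Γ ∧
        (∀ᶠ δ in 𝓝[>] (0:ℝ), AEMeasurable (fun ω => CurveClass.mk (Y δ ω)) (P δ)) ∧
        TendstoLaw (fun δ ω => CurveClass.mk (Y δ ω)) P (fun ω => (Γ ω).reverse)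
          Literature.Probability.Process.preWienerMeasure := by
  have hev : ∀ᶠ δ in 𝓝[>] (0:ℝ),
      (fun ω => if c δ ω then CurveClass.mk (Y δ ω) else (CurveClass.mk (Y δ ω)).reverse) =
        fun ω => (CurveClass.mk (Y δ ω)).reverse :=
    h.mono fun δ hδ => funext fun ω => by rw [if_neg (hδ ω)]
  rw [convergesInLawToSLE_congr (P := P) hev]
  unfold ConvergesInLawToSLE
  refine exists_congr fun Γ => and_congr_right fun _ => and_congr ?_ ?_
  · exact Filter.eventually_congr (Eventually.of_forall fun δ => aemeasurable_reverse_comp_iff)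
  · exact tendstoLaw_reverse_iff

/-- **General form, `then` branch**: if the test eventually HOLDS for every configuration, the
re-oriented family converges to SLE_κ iff the raw family does. [folklore] -/
theorem convergesInLawToSLE_ite_iff_of_eventually {Ωδ : ℝ → Type*} [∀ δ, MeasurableSpace (Ωδ δ)]
    {Y : ∀ δ, Ωδ δ → Curve ℂ} {c : ∀ δ, Ωδ δ → Prop} [∀ δ ω, Decidable (c δ ω)]
    {P : ∀ δ, Measure (Ωδ δ)} {κ : ℝ≥0} {D : DobrushinDomain}
    (h : ∀ᶠ δ in 𝓝[>] (0:ℝ), ∀ ω, c δ ω) :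
    ConvergesInLawToSLE κ D
        (fun δ ω => if c δ ω then CurveClass.mk (Y δ ω) else (CurveClass.mk (Y δ ω)).reverse) P ↔
      ConvergesInLawToSLE κ D (fun δ ω => CurveClass.mk (Y δ ω)) P :=
  convergesInLawToSLE_congr (h.mono fun δ hδ => funext fun ω => by rw [if_pos (hδ ω)])

/-- **What the conclusion says on the unit-disc family**: the RAW exploration of `discData δ`
(started at `b_δ → b = -1`, ended at `a_δ → a = 1`) converges in law to the TIME-REVERSAL of a
chordal SLE₆ in `(𝔻; 1, -1)`. [folklore] -/
theorem conclusion_discData_iff_raw :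
    ConvergesInLawToSLE 6 DobrushinDomain.unitDisc (Ωδ := fun _ => BondConfig (Site 2))
        (fun δ ω => iface DobrushinDomain.unitDisc (discData δ) ω)
        (fun _ => bondPercolation (zdGraph 2) half) ↔
      ∃ Γ, IsSLECurve 6 DobrushinDomain.unitDisc Γ ∧
        (∀ᶠ δ in 𝓝[>] (0:ℝ), AEMeasurable
          (fun ω => CurveClass.mk (⟨medialExplorationCurve (discData δ) ω⟩ : Curve ℂ))
          (bondPercolation (zdGraph 2) half)) ∧
        TendstoLaw (Ωδ := fun _ => BondConfig (Site 2))
          (fun δ ω => CurveClass.mk (⟨medialExplorationCurve (discData δ) ω⟩ : Curve ℂ))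
          (fun _ => bondPercolation (zdGraph 2) half) (fun ω => (Γ ω).reverse)
          Literature.Probability.Process.preWienerMeasure := by
  have hev : ∀ᶠ δ in 𝓝[>] (0:ℝ), (fun ω => iface DobrushinDomain.unitDisc (discData δ) ω) =
      fun ω => (CurveClass.mk (⟨medialExplorationCurve (discData δ) ω⟩ : Curve ℂ)).reverse := by
    filter_upwards [Ioo_mem_nhdsGT (show (0:ℝ) < 1 / 3 by norm_num)] with δ hδ
    funext ω
    exact iface_discData_eq_reverse hδ.1 hδ.2 ω
  rw [convergesInLawToSLE_congr (P := fun _ => bondPercolation (zdGraph 2) half) hev]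
  unfold ConvergesInLawToSLE
  refine exists_congr fun Γ => and_congr_right fun _ => and_congr ?_ ?_
  · exact Filter.eventually_congr (Eventually.of_forall fun δ => aemeasurable_reverse_comp_iff)
  · exact tendstoLaw_reverse_iff

/-- **The orientation tax.** GIVEN reversibility of chordal SLE₆ on the disc (the law of the
time-reversal of an SLE₆ in `(𝔻; 1, -1)` is the law of an SLE₆ in the swapped domain
`(𝔻; -1, 1)`; Miller–Sheffield, Ann. Math. 184 (2016) 455–486, for `κ ∈ (4, 8)` — NOT in the
tree), the conclusion on the unit-disc family is equivalent to the NATURAL statement for an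
exploration process: the raw exploration, from its start `b_δ` to its end `a_δ`, converges in law
to chordal SLE₆ in `(𝔻; -1, 1)` — which is what a domain-Markov / martingale-observable argument
run along the exploration's own filtration produces. Without that input the tree has no bridge
between the two. (Reference for the hypothesis: J. Miller, S. Sheffield, *Imaginary geometry III:
reversibility of SLE_κ for κ ∈ (4,8)*, Ann. of Math. 184 (2016) 455–486, main theorem.) [folklore] -/
theorem conclusion_discData_iff_natural_of_reversible
    (hrev : ∀ Γ Γ', IsSLECurve 6 DobrushinDomain.unitDisc Γ →
      IsSLECurve 6 DobrushinDomain.unitDisc.swap Γ' →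
        Literature.Probability.Process.preWienerMeasure.map (fun ω => (Γ ω).reverse) =
          Literature.Probability.Process.preWienerMeasure.map Γ') :
    ConvergesInLawToSLE 6 DobrushinDomain.unitDisc (Ωδ := fun _ => BondConfig (Site 2))
        (fun δ ω => iface DobrushinDomain.unitDisc (discData δ) ω)
        (fun _ => bondPercolation (zdGraph 2) half) ↔
      ∃ Γ', IsSLECurve 6 DobrushinDomain.unitDisc.swap Γ' ∧
        (∀ᶠ δ in 𝓝[>] (0:ℝ), AEMeasurable
          (fun ω => CurveClass.mk (⟨medialExplorationCurve (discData δ) ω⟩ : Curve ℂ))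
          (bondPercolation (zdGraph 2) half)) ∧
        TendstoLaw (Ωδ := fun _ => BondConfig (Site 2))
          (fun δ ω => CurveClass.mk (⟨medialExplorationCurve (discData δ) ω⟩ : Curve ℂ))
          (fun _ => bondPercolation (zdGraph 2) half) Γ'
          Literature.Probability.Process.preWienerMeasure := by
  rw [conclusion_discData_iff_raw]
  -- the integral of a test function against the reversed SLE₆ is that against the swapped SLE₆
  have key : ∀ {Γ Γ'}, IsSLECurve 6 DobrushinDomain.unitDisc Γ →
      IsSLECurve 6 DobrushinDomain.unitDisc.swap Γ' → ∀ f : BoundedContinuousFunction (CurveClass ℂ) ℝ,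
        ∫ ω, f ((Γ ω).reverse) ∂Literature.Probability.Process.preWienerMeasure =
          ∫ ω, f (Γ' ω) ∂Literature.Probability.Process.preWienerMeasure := by
    intro Γ Γ' hΓ hΓ' f
    have h1 : AEMeasurable (fun ω => (Γ ω).reverse) Literature.Probability.Process.preWienerMeasure :=
      CurveClass.measurable_reverse.comp_aemeasurable hΓ.1
    rw [← integral_map h1 f.continuous.aestronglyMeasurable,
      ← integral_map hΓ'.1 f.continuous.aestronglyMeasurable, hrev Γ Γ' hΓ hΓ']
  constructor
  · rintro ⟨Γ, hΓ, hmeas, hlaw⟩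
    obtain ⟨Γ', hΓ'⟩ := exists_isSLECurve_six DobrushinDomain.unitDisc.swap
    refine ⟨Γ', hΓ', hmeas, fun f => ?_⟩
    rw [← key hΓ hΓ' f]
    exact hlaw f
  · rintro ⟨Γ', hΓ', hmeas, hlaw⟩
    obtain ⟨Γ, hΓ⟩ := exists_isSLECurve_six DobrushinDomain.unitDisc
    refine ⟨Γ, hΓ, hmeas, fun f => ?_⟩
    rw [key hΓ hΓ' f]
    exact hlaw f

end OrientationTax

end Summit.CriticalPhenomena.CardyFormulaZ2.Cruxes.ParafermionFamiliesToSLESix.Disproof
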